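import Mathlib
import Literature.MathematicalPhysics.QuantumFieldTheory.CurvatureGaussianField
import Literature.MathematicalPhysics.QuantumFieldTheory.GaussianToolkit
import HarnessLib

/-!
# `Balaban1983to89.B1Eq324BenfattoClassAppendixC` — APPENDIX C of G. Benfatto, M. Cassandro, G. Gallavotti, F. Nicolò, E. Olivieri,
# E. Presutti, E. Scacciatelli, *Some probabilistic techniques in field theory*, Commun. Math. Phys. **59** (1978) 143–166
# [BenfattoEtAl1978], (C.2), (C.6)–(C.9) pp. 164–165, FOR A CLASS OF GAUSSIAN VECTORS: finite index set with a pseudometric,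
# covariance `G = A⁻¹` of a symmetric precision `A` that is uniformly elliptic with exponentially decaying entries (Combes–Thomas
# currency) — every bound PROVED, with constants UNIFORM in the conditioning set

statement-level skeleton of published theorems with citation tags; proofs where landed; nothing here is a claim about the
Yang–Mills mass gap

WHY THIS MODULE (cell `pub-ymgap`, seat `dag-n08-b` gen 7 = node N08 [Balaban1985UV3] «first missing estimate» lane).  The chain
[Balaban1985UV3] (24) p. 262 / (58) p. 270 ← [Balaban1982Higgs1] (3.24) p. 616 ← [BenfattoEtAl1978] Lemma p. 152 is now a tree
THEOREM at the printed model (`B1Eq324BenfattoSect5BasicLemma.basicLemmaPrinted_holds`, 2026-08-28): the Basic Lemma holds for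
the nearest-neighbour Gaussian Markov field `P̂₀` of (1.1)/(C.1).  But the Gaussian measure to which B10 applies «the cumulant
expansion formula (3.24) [8]» is `dμ_{C^{(k)}}` of (58) — «a Gaussian measure with a covariance having an exponential decay property
(and many other properties, see Sect. E in [5])» (p. 261), determined by «the quadratic form ⟨A, Δ_kA⟩ and the δ-functions» (p. 271)
— NOT the field (C.1); and [Balaban1982Higgs1] p. 616 justifies the transfer only by «the lemma formulated on p. 152 of this paper can
be applied in our situation because all the assumptions are satisfied».  The honest next link on the (3.24) row is therefore a Basic
Lemma for a CLASS of Gaussian fields (seat dag-n08-w4's located note `N08-IDENT-BRIDGE-NOTE.md`, 2026-08-28, hypotheses H1–H5), and,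
walking §5 of [BenfattoEtAl1978] in printed order, the FIRST free-field input of its proof that the tree holds only at the concrete
field `freeCov d α β` is Appendix C: the decay (C.2) of the covariance, the conditional («Dirichlet») covariance bounds (C.6), the
conditional centre (C.7)–(C.8), and Lemma 1 (C.9) (tree: `…AppendixC2`, `…CondCentre`, `…AppendixCLemma2`, `…AppendixC` — all by the
massive maximum principle / positivity of the n.n. field).  This file proves the class form of each, from hypotheses on the
PRECISION that are the shape of Bałaban's propagator theorems (uniform lower bound of the quadratic form; exponential decay of the
kernel), by the Combes–Thomas conjugation argument [CombesThomas1973] instead of the maximum principle.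

THE PRINTED TEXT being generalised (p. 164, verbatim from the page images `HOME/inprint/lit-balaban-lead/benfatto1978-cmp59/bcg_p164-*.png`):
*"1) The covariance C_{Δ,Δ′} is such that … `0 ≦ C_{ΔΔ′} = … ≦ (1/(βα²))(1 + α²/2d)^{−d(Δ,Δ′)} ≡ ‖c‖e^{−ϰ′d(Δ,Δ′)}` (C.2) …
`0 ≦ C_{ΔΔ′} < 1/2` (C.4) … 2) Let Γ be a region paved by Q₀ and let P̂₀(dz|z_Γ) denotes the above probability measure conditioned to
fixed values of the z_Δ's, Δ ∈ Γ. Then the conditioned variables (z_Δ)_{Δ∉Γ} are a non centered gaussian field with covariance C^Γ_{ΔΔ′}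
such that `0 ≦ C^Γ_{ΔΔ′} ≦ C_{ΔΔ′}` (C.6) and center `u_Δ = β Σ_{Δ′⊂Γ} (Σ_{Δ″∉Γ, Δ″ n.n. to Δ′} C^Γ_{ΔΔ″}) z_{Δ′}` (C.7).  C^Γ_{Δ,Δ′} is
the covariance with “Ditrichelet boundary condition” on Γ. Hence using (C.6) (C.3), if |z_Δ| < b(1 + d(Δ, I)),
`|u_Δ| ≦ ((α² + 2d)/α²)² b(1 + d(Δ, I))` (C.8). The above properties are well-known [7]."*; p. 165 Lemma 1 (C.9): see
`B1Eq324BenfattoAppendixC` (there AS PRINTED, with «C_ij > 0»).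

THE CLASS (dictionary).  `ι` a finite index set («the tesserae», or Bałaban's bonds × Lie-algebra components) with a pseudometric
`dist` (three axioms as hypotheses: `dist e e = 0`, symmetry, triangle inequality; several variables may sit at distance 0);
`A : Matrix ι ι ℝ` the PRECISION, symmetric (`A e e′ = A e′ e`), uniformly elliptic `γ·Σ x_e² ≤ Σ A e e′ x_e x_{e′}` (`γ > 0`), with
exponentially decaying entries in Combes–Thomas currency: `Σ_{e′} |A e e′|(cosh(κ·dist e e′) − 1) ≤ J` with `J < γ`, `κ ≥ 0` (finite range
AND infinite range with exponential tails are admitted; for (C.1) `A = β(−Δ + α²)`, `γ = βα²`, `J = 2dβ(cosh κ − 1)`).  The covariance is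
`G = A⁻¹` (Lean: `A⁻¹`, Mathlib's `Matrix.inv`; CAUTION for users: inside `covGram · Γ`, whose argument is a bare function `ι → ι → ℝ`,
write `(A⁻¹ : Matrix ι ι ℝ)` — an unannotated `A⁻¹` at a function type elaborates to the POINTWISE inverse).  Conditioning on the
coordinates in `Γ : Finset ι`: the conditional covariance is the Schur complement `G_{yy′} − Σ_{c,c′∈Γ} G_{yc}(G_ΓΓ)⁻¹_{cc′}G_{c′y′}` and
the conditional centre given boundary data `ξ` is the regression `Σ_{c,c′∈Γ} G_{yc}(G_ΓΓ)⁻¹_{cc′}ξ_{c′}` — LITERALLY the bodies of the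
chain's `B1Eq324BenfattoLemma.condCov G Γ y y′` / `condMean G Γ ξ y` (which are typed on the infinite `Site d`; here `ι` is finite,
which is the situation of [Balaban1985UV3] (58): one torus block), with `covGram` the tree's Gram matrix
(`CurvatureGaussianField.covGram`).  §4 proves that these ARE print's objects in precision form: `C^Γ = (A|_{Γᶜ})⁻¹` («Dirichlet
boundary condition on Γ») and `u = −(A|_{Γᶜ})⁻¹ A_{ΓᶜΓ} ξ` (= (C.7) at `A = β(−Δ + α²)`).

WHAT IS PROVED (no definition, no named fact, no `sorry`; axioms standard).
* §1 the real PAIRWISE Combes–Thomas bound: `weightedForm_coercive_pairwise` ((γ − J)-coercivity of the `e^{κ(ρ_e − ρ_{e′})}`-conjugated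
  form under the pairwise row defect), `combesThomas_pairwise_real` (`|u·x| ≤ e^{−κR}(γ − J)⁻¹‖u‖‖v‖` for `Ax = v`, supports separated
  by `R` in the weight `ρ`) — the one-scale tree version is `MassGapFunctionalInequalities.combesThomas_cosh_bound` (range-one hopping),
  the complex Hermitian pairwise version `Beta.DeltaACombesThomas.combesThomas_pairwise` (β-cell, heavy imports); this is the real
  pairwise form the Gaussian chain needs, self-contained.
* §2 the class: `posDef_of_coercive`; **(C.2)-class** `abs_inv_apply_le_exp` (`|G_{xy}| ≤ e^{−κ·dist x y}/(γ − J)`); **(C.4)-class**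
  `inv_apply_self_pos_le` (`0 < G_{xx} ≤ 1/γ`).
* §3 principal blocks inherit the class with the SAME constants: `coercive_submatrix`, `abs_inv_submatrix_apply_le_exp`,
  `inv_submatrix_apply_self_pos_le` — uniformity in the deleted set is what makes every conditional bound below uniform in `Γ`.
* §4 conditioning in precision form: `submatrix_mul_add_submatrix_compl_mul` (block product along `Γ ⊔ Γᶜ`), `precision_block_cc/_cΓ`
  (the `Γᶜ`-rows of `AG = 1`), `isUnit_det_covGram_inv`, `isUnit_det_submatrix_compl`, **`regression_eq_neg_inv_submatrix_mul`**
  (`G_{ΓᶜΓ}(G_ΓΓ)⁻¹ = −(A|_{Γᶜ})⁻¹A_{ΓᶜΓ}`), **`schur_eq_inv_submatrix_compl`** (`condCov`-body `= ((A|_{Γᶜ})⁻¹)_{yy′}`),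
  **`regression_apply_eq`** (`condMean`-body `= −Σ_{z∉Γ}((A|_{Γᶜ})⁻¹)_{yz}Σ_{c∈Γ}A_{zc}ξ_c`, print's (C.7)), `cov_sub_schur_eq`.
* §5 Appendix C for the class, all constants UNIFORM IN `Γ`: **(C.6)-class** `abs_schur_le_exp` (`|C^Γ_{yy′}| ≤ e^{−κ·dist y y′}/(γ − J)`),
  `schur_self_pos_le` (`0 < C^Γ_{yy} ≤ 1/γ`); **(C.8)-class** `abs_regression_le` (`|u_y| ≤ (γ − J)⁻¹Σ_{z∉Γ}e^{−κ·dist y z}Σ_{c∈Γ}|A_{zc}||ξ_c|`)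
  and `abs_regression_le_profile` (print's growing thresholds: `|ξ_c| ≤ t(1 + δ_c)` on `Γ`, `δ` 1-Lipschitz ⇒ `|u_y| ≤ (VM/(γ − J))t(1 + δ_y)`);
  **(C.7)-class** `abs_cov_sub_schur_le` and `abs_cov_sub_schur_le_exp` (`|G_{yy′} − C^Γ_{yy′}| ≤ (V₂M₂/(γ − J)²)e^{−(κ/2)(dist(y,Γ) + dist(Γ,y′))}`).
* (sequel `B1Eq324BenfattoClassAppendixCLemma1`) **(C.9)-class** `measureReal_forall_lt_abs_le_exp`: Lemma 1 WITHOUT «C_ij > 0»,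
  `‖C‖ := sup_i Σ_j |C_ij|` (the positive printed case on `Fin n` is `B1Eq324BenfattoAppendixC.appC_lemma1`).
* §7 (v1.1, append-only) **(C.5)-class** `sum_abs_inv_apply_le` (`Σ_y|G_{xy}| ≤ V₀/(γ−J)`), `sum_abs_schur_le` (the same for `C^Γ`, uniform in `Γ`),
  `regression_sub` (linearity of the centre in the boundary data).
* §6 the covariance-side door: `rowDefect_le_of_abs_le_exp` (entry decay + growth sum ⇒ Combes–Thomas defect at a smaller rate),
  `coercive_inv_of_form_le` (`⟨x,Gx⟩ ≤ Λ‖x‖²` ⇒ `G⁻¹` is `1/Λ`-elliptic) — so the class can be ENTERED from bounds stated on the covariance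
  (apply §2 to `G` to get the decay of `A = G⁻¹`), the currency of B10 p. 261.

HONEST SCOPE.  Kernel-generic matrix analysis; the «class» is a READING of [Balaban1982Higgs1] p. 616 «all the assumptions are
satisfied», not print.  The POSITIVITY half of (C.2)/(C.6) (`0 ≦ C_{ΔΔ′}`, `0 ≦ C^Γ_{ΔΔ′}`) is NOT claimed for the class (it is false
for general elliptic precisions; the §5 road uses absolute values).  Nothing downstream of Appendix C (Appendix A for the class, the
Markov / decoupling step across corridors, §5's pavement iteration) is touched here: those are the next class-form items.  Nothing of
[Balaban1985UV3] / [Balaban1982Higgs1] is asserted; whether Bałaban's `Δ_k` of (58) lies in the class is the in-edge N06 ([5] Sect. E),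
not this file.  Count-neutral for N08; NOT summit progress; nothing continuum / OS / mass-gap / Clay.
-/

noncomputable section

open Finset Matrix
open scoped BigOperators

namespace Literature.MathematicalPhysics.QuantumFieldTheory.Balaban1983to89.B1Eq324BenfattoClassAppendixC

open Literature.MathematicalPhysics.QuantumFieldTheory
open Literature.MathematicalPhysics.QuantumFieldTheory.GaussianToolkit

variable {ι : Type*} [Fintype ι] [DecidableEq ι]

/-! ## §1  The real PAIRWISE Combes–Thomas bound (cosh law, entries of every range) -/

omit [DecidableEq ι] in
/-- **Coercivity of the exponentially conjugated form, pairwise weights.**  For a symmetric real kernel `A` with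
`γ‖z‖² ≤ ⟨z, Az⟩` and PAIRWISE row defect `Σ_{e′} |A e e′|·(cosh(κ(ρ_e − ρ_{e′})) − 1) ≤ J` at the weight `ρ`, the conjugated
form stays coercive: `(γ − J)‖z‖² ≤ Σ_{e,e′} e^{κ(ρ_e − ρ_{e′})} A e e′ z_e z_{e′}` (symmetrise the weight to `cosh`, split off the
unweighted form, Schur's test on the symmetric weight `|A e e′|(cosh(κ(ρ_e − ρ_{e′})) − 1)`).  Unlike the one-scale version
(`MassGapFunctionalInequalities.weightedForm_coercive`: range-one hopping, `J(cosh κ − 1)`), every entry carries its own weight, so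
kernels of unbounded range with exponentially decaying entries are admitted. [cite: CombesThomas1973, §II (the conjugation argument)] -/
theorem weightedForm_coercive_pairwise {A : Matrix ι ι ℝ} (hA : ∀ e e', A e e' = A e' e) (ρ : ι → ℝ)
    {γ J : ℝ} (κ : ℝ)
    (hγ : ∀ x : ι → ℝ, γ * ∑ e, x e ^ 2 ≤ ∑ e, ∑ e', A e e' * x e * x e')
    (hJ : ∀ e, ∑ e', |A e e'| * (Real.cosh (κ * (ρ e - ρ e')) - 1) ≤ J) (z : ι → ℝ) :
    (γ - J) * ∑ e, z e ^ 2 ≤ ∑ e, ∑ e', Real.exp (κ * (ρ e - ρ e')) * A e e' * z e * z e' := by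
  set w : ι → ι → ℝ := fun e e' => |A e e'| * (Real.cosh (κ * (ρ e - ρ e')) - 1) with hw
  have hc0 : ∀ e e', 0 ≤ Real.cosh (κ * (ρ e - ρ e')) - 1 := fun e e' => by
    linarith [Real.one_le_cosh (κ * (ρ e - ρ e'))]
  have hw0 : ∀ e e', 0 ≤ w e e' := fun e e' => mul_nonneg (abs_nonneg _) (hc0 e e')
  have hwsymm : ∀ e e', w e e' = w e' e := by
    intro e e'
    simp only [hw]
    rw [hA e e', show κ * (ρ e' - ρ e) = -(κ * (ρ e - ρ e')) by ring, Real.cosh_neg]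
  -- (1) symmetrisation of the weight
  have hswap : ∑ e, ∑ e', Real.exp (κ * (ρ e - ρ e')) * A e e' * z e * z e'
      = ∑ e, ∑ e', Real.exp (-(κ * (ρ e - ρ e'))) * A e e' * z e * z e' := by
    rw [Finset.sum_comm]
    refine Finset.sum_congr rfl fun e _ => Finset.sum_congr rfl fun e' _ => ?_
    rw [hA e' e, show -(κ * (ρ e - ρ e')) = κ * (ρ e' - ρ e) by ring]
    ring
  have hsymm : ∑ e, ∑ e', Real.exp (κ * (ρ e - ρ e')) * A e e' * z e * z e'
      = ∑ e, ∑ e', Real.cosh (κ * (ρ e - ρ e')) * A e e' * z e * z e' := by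
    have key : ∀ s t : ℝ, s = t → s = (s + t) / 2 := by intro s t h; rw [h]; ring
    rw [key _ _ hswap, ← Finset.sum_add_distrib, Finset.sum_div]
    refine Finset.sum_congr rfl fun e _ => ?_
    rw [← Finset.sum_add_distrib, Finset.sum_div]
    refine Finset.sum_congr rfl fun e' _ => ?_
    rw [Real.cosh_eq]
    ring
  -- (2) split off the unweighted form
  have hsplit : ∑ e, ∑ e', Real.cosh (κ * (ρ e - ρ e')) * A e e' * z e * z e'
      = (∑ e, ∑ e', A e e' * z e * z e')
        + ∑ e, ∑ e', (Real.cosh (κ * (ρ e - ρ e')) - 1) * A e e' * z e * z e' := by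
    rw [← Finset.sum_add_distrib]
    refine Finset.sum_congr rfl fun e _ => ?_
    rw [← Finset.sum_add_distrib]
    refine Finset.sum_congr rfl fun e' _ => ?_
    ring
  -- (3) termwise: the perturbation is `≥ −w(e,e′)(z_e² + z_{e′}²)/2`
  have hterm : ∀ e e', -(w e e' * ((z e ^ 2 + z e' ^ 2) / 2)) ≤
      (Real.cosh (κ * (ρ e - ρ e')) - 1) * A e e' * z e * z e' := by
    intro e e'
    have habs : |(Real.cosh (κ * (ρ e - ρ e')) - 1) * A e e' * z e * z e'| = w e e' * (|z e| * |z e'|) := by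
      rw [abs_mul, abs_mul, abs_mul, abs_of_nonneg (hc0 e e')]
      simp only [hw]
      ring
    have hamgm : |z e| * |z e'| ≤ (z e ^ 2 + z e' ^ 2) / 2 := by
      nlinarith [sq_nonneg (|z e| - |z e'|), sq_abs (z e), sq_abs (z e')]
    have h := neg_abs_le ((Real.cosh (κ * (ρ e - ρ e')) - 1) * A e e' * z e * z e')
    rw [habs] at h
    nlinarith [hw0 e e']
  -- (4) Schur's test on the symmetric weight `w`
  have hA1 : ∑ e, ∑ e', w e e' * z e ^ 2 ≤ J * ∑ e, z e ^ 2 := by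
    calc ∑ e, ∑ e', w e e' * z e ^ 2 = ∑ e, (∑ e', w e e') * z e ^ 2 := by
          refine Finset.sum_congr rfl fun e _ => ?_
          rw [Finset.sum_mul]
      _ ≤ ∑ e, J * z e ^ 2 := Finset.sum_le_sum fun e _ => mul_le_mul_of_nonneg_right (hJ e) (sq_nonneg _)
      _ = J * ∑ e, z e ^ 2 := by rw [Finset.mul_sum]
  have hA2 : ∑ e, ∑ e', w e e' * z e' ^ 2 ≤ J * ∑ e, z e ^ 2 := by
    rw [Finset.sum_comm]
    calc ∑ e', ∑ e, w e e' * z e' ^ 2 = ∑ e', (∑ e, w e e') * z e' ^ 2 := by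
          refine Finset.sum_congr rfl fun e' _ => ?_
          rw [Finset.sum_mul]
      _ ≤ ∑ e', J * z e' ^ 2 := by
          refine Finset.sum_le_sum fun e' _ => mul_le_mul_of_nonneg_right ?_ (sq_nonneg _)
          calc ∑ e, w e e' = ∑ e, w e' e := Finset.sum_congr rfl fun e _ => hwsymm e e'
            _ ≤ J := hJ e'
      _ = J * ∑ e, z e ^ 2 := by rw [Finset.mul_sum]
  have hsum : ∑ e, ∑ e', w e e' * ((z e ^ 2 + z e' ^ 2) / 2)
      = ((∑ e, ∑ e', w e e' * z e ^ 2) + ∑ e, ∑ e', w e e' * z e' ^ 2) / 2 := by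
    rw [← Finset.sum_add_distrib, Finset.sum_div]
    refine Finset.sum_congr rfl fun e _ => ?_
    rw [← Finset.sum_add_distrib, Finset.sum_div]
    refine Finset.sum_congr rfl fun e' _ => ?_
    ring
  have hschur : ∑ e, ∑ e', w e e' * ((z e ^ 2 + z e' ^ 2) / 2) ≤ J * ∑ e, z e ^ 2 := by
    rw [hsum]
    linarith
  have hoff : -(J * ∑ e, z e ^ 2) ≤ ∑ e, ∑ e', (Real.cosh (κ * (ρ e - ρ e')) - 1) * A e e' * z e * z e' := by
    have h1 : -(∑ e, ∑ e', w e e' * ((z e ^ 2 + z e' ^ 2) / 2))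
        ≤ ∑ e, ∑ e', (Real.cosh (κ * (ρ e - ρ e')) - 1) * A e e' * z e * z e' := by
      rw [← Finset.sum_neg_distrib]
      refine Finset.sum_le_sum fun e _ => ?_
      rw [← Finset.sum_neg_distrib]
      exact Finset.sum_le_sum fun e' _ => hterm e e'
    linarith
  -- (5) assemble
  have hγz := hγ z
  rw [hsymm, hsplit, sub_mul]
  linarith

omit [DecidableEq ι] in
/-- **The real pairwise Combes–Thomas bound.**  Under the hypotheses of `weightedForm_coercive_pairwise` with `κ ≥ 0` and
`J < γ`: if `Σ_{e′} A e e′ x_{e′} = v_e`, `v` is supported in `{ρ ≤ 0}` and `u` in `{R ≤ ρ}`, then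
`|Σ u_e x_e| ≤ e^{−κR}(γ − J)⁻¹‖u‖‖v‖` — read on a positive definite precision `A` of a Gaussian vector `X`:
`|Cov(u·X, v·X)| = |u·A⁻¹v| ≤ e^{−κR}(γ − J)⁻¹‖u‖‖v‖`.  (Steps (a)–(f) of the tree's one-scale
`MassGapFunctionalInequalities.combesThomas_cosh_bound`, with the pairwise coercivity in step (c).) [cite: CombesThomas1973, §II] -/
theorem combesThomas_pairwise_real {A : Matrix ι ι ℝ} (hA : ∀ e e', A e e' = A e' e) (ρ : ι → ℝ)
    {γ J κ R : ℝ}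
    (hγ : ∀ x : ι → ℝ, γ * ∑ e, x e ^ 2 ≤ ∑ e, ∑ e', A e e' * x e * x e')
    (hJ : ∀ e, ∑ e', |A e e'| * (Real.cosh (κ * (ρ e - ρ e')) - 1) ≤ J)
    (hκ : 0 ≤ κ) (hm : J < γ)
    {u v x : ι → ℝ} (hx : ∀ e, ∑ e', A e e' * x e' = v e)
    (hu : ∀ e, u e ≠ 0 → R ≤ ρ e) (hv : ∀ e, v e ≠ 0 → ρ e ≤ 0) :
    |∑ e, u e * x e| ≤ Real.exp (-(κ * R)) / (γ - J) *
      (Real.sqrt (∑ e, u e ^ 2) * Real.sqrt (∑ e, v e ^ 2)) := by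
  set m := γ - J with hmdef
  have hm0 : 0 < m := by rw [hmdef]; linarith
  -- weighted unknown and data
  set z : ι → ℝ := fun e => Real.exp (κ * ρ e) * x e with hz
  set w : ι → ℝ := fun e => Real.exp (κ * ρ e) * v e with hw
  -- (a) the conjugated equation
  have hconj : ∀ e, ∑ e', Real.exp (κ * (ρ e - ρ e')) * A e e' * z e' = w e := by
    intro e
    have : ∀ e', Real.exp (κ * (ρ e - ρ e')) * A e e' * z e' = Real.exp (κ * ρ e) * (A e e' * x e') := by
      intro e'
      simp only [hz]
      rw [show κ * (ρ e - ρ e') = κ * ρ e - κ * ρ e' by ring, Real.exp_sub]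
      have hpos : Real.exp (κ * ρ e') ≠ 0 := (Real.exp_pos _).ne'
      field_simp
    simp_rw [this, ← Finset.mul_sum, hx e, hw]
  -- (b) the conjugated quadratic form is `Σ z w`
  have hquad : ∑ e, ∑ e', Real.exp (κ * (ρ e - ρ e')) * A e e' * z e * z e' = ∑ e, z e * w e := by
    refine Finset.sum_congr rfl fun e _ => ?_
    rw [← hconj e, Finset.mul_sum]
    refine Finset.sum_congr rfl fun e' _ => ?_
    ring
  -- (c) pairwise coercivity + Cauchy–Schwarz
  have hcoer := weightedForm_coercive_pairwise hA ρ κ hγ hJ z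
  rw [hquad] at hcoer
  have hZ0 : 0 ≤ ∑ e, z e ^ 2 := Finset.sum_nonneg fun e _ => sq_nonneg _
  have hW0 : 0 ≤ ∑ e, w e ^ 2 := Finset.sum_nonneg fun e _ => sq_nonneg _
  have hCS : ∑ e, z e * w e ≤ Real.sqrt (∑ e, z e ^ 2) * Real.sqrt (∑ e, w e ^ 2) := by
    have h := Finset.sum_mul_sq_le_sq_mul_sq Finset.univ z w
    calc ∑ e, z e * w e ≤ |∑ e, z e * w e| := le_abs_self _
      _ ≤ Real.sqrt ((∑ e, z e ^ 2) * ∑ e, w e ^ 2) := Real.abs_le_sqrt h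
      _ = Real.sqrt (∑ e, z e ^ 2) * Real.sqrt (∑ e, w e ^ 2) := Real.sqrt_mul hZ0 _
  have hzle : m * Real.sqrt (∑ e, z e ^ 2) ≤ Real.sqrt (∑ e, w e ^ 2) := by
    by_cases hZ : Real.sqrt (∑ e, z e ^ 2) = 0
    · rw [hZ, mul_zero]; exact Real.sqrt_nonneg _
    · have hZpos : 0 < Real.sqrt (∑ e, z e ^ 2) := lt_of_le_of_ne (Real.sqrt_nonneg _) (Ne.symm hZ)
      have key : m * (Real.sqrt (∑ e, z e ^ 2) * Real.sqrt (∑ e, z e ^ 2))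
          ≤ Real.sqrt (∑ e, z e ^ 2) * Real.sqrt (∑ e, w e ^ 2) := by
        rw [Real.mul_self_sqrt hZ0]; exact hcoer.trans hCS
      have key' : (m * Real.sqrt (∑ e, z e ^ 2)) * Real.sqrt (∑ e, z e ^ 2)
          ≤ Real.sqrt (∑ e, w e ^ 2) * Real.sqrt (∑ e, z e ^ 2) := by
        calc (m * Real.sqrt (∑ e, z e ^ 2)) * Real.sqrt (∑ e, z e ^ 2)
            = m * (Real.sqrt (∑ e, z e ^ 2) * Real.sqrt (∑ e, z e ^ 2)) := by ring
          _ ≤ Real.sqrt (∑ e, z e ^ 2) * Real.sqrt (∑ e, w e ^ 2) := key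
          _ = Real.sqrt (∑ e, w e ^ 2) * Real.sqrt (∑ e, z e ^ 2) := mul_comm _ _
      exact le_of_mul_le_mul_right key' hZpos
  -- (d) the data weight is `≤ 1` on the support of `v`
  have hwv : ∑ e, w e ^ 2 ≤ ∑ e, v e ^ 2 := by
    refine Finset.sum_le_sum fun e _ => ?_
    simp only [hw]
    by_cases hve : v e = 0
    · simp [hve]
    · have hexp1 : Real.exp (κ * ρ e) ≤ 1 := by
        rw [Real.exp_le_one_iff]
        exact mul_nonpos_of_nonneg_of_nonpos hκ (hv e hve)
      have hexp0 : 0 ≤ Real.exp (κ * ρ e) := (Real.exp_pos _).le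
      rw [mul_pow]
      calc Real.exp (κ * ρ e) ^ 2 * v e ^ 2 ≤ 1 ^ 2 * v e ^ 2 := by gcongr
        _ = v e ^ 2 := by ring
  -- (e) the observable weight is `≤ e^{−κR}` on the support of `u`
  have hux : ∑ e, u e * x e = ∑ e, (u e * Real.exp (-(κ * ρ e))) * z e := by
    refine Finset.sum_congr rfl fun e _ => ?_
    simp only [hz]
    rw [Real.exp_neg]
    have hpos : Real.exp (κ * ρ e) ≠ 0 := (Real.exp_pos _).ne'
    field_simp
  have hU : ∑ e, (u e * Real.exp (-(κ * ρ e))) ^ 2 ≤ Real.exp (-(κ * R)) ^ 2 * ∑ e, u e ^ 2 := by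
    rw [Finset.mul_sum]
    refine Finset.sum_le_sum fun e _ => ?_
    by_cases hue : u e = 0
    · simp [hue]
    · have hle : Real.exp (-(κ * ρ e)) ≤ Real.exp (-(κ * R)) := by
        rw [Real.exp_le_exp]
        have := mul_le_mul_of_nonneg_left (hu e hue) hκ
        linarith
      have h0 : 0 ≤ Real.exp (-(κ * ρ e)) := (Real.exp_pos _).le
      rw [mul_pow]
      calc u e ^ 2 * Real.exp (-(κ * ρ e)) ^ 2 ≤ u e ^ 2 * Real.exp (-(κ * R)) ^ 2 := by gcongr
        _ = Real.exp (-(κ * R)) ^ 2 * u e ^ 2 := mul_comm _ _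
  have hCS2 : |∑ e, (u e * Real.exp (-(κ * ρ e))) * z e|
      ≤ Real.exp (-(κ * R)) * Real.sqrt (∑ e, u e ^ 2) * Real.sqrt (∑ e, z e ^ 2) := by
    have h := Finset.sum_mul_sq_le_sq_mul_sq Finset.univ (fun e => u e * Real.exp (-(κ * ρ e))) z
    have hU0 : 0 ≤ ∑ e, (u e * Real.exp (-(κ * ρ e))) ^ 2 := Finset.sum_nonneg fun e _ => sq_nonneg _
    calc |∑ e, (u e * Real.exp (-(κ * ρ e))) * z e|
        ≤ Real.sqrt ((∑ e, (u e * Real.exp (-(κ * ρ e))) ^ 2) * ∑ e, z e ^ 2) := Real.abs_le_sqrt h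
      _ = Real.sqrt (∑ e, (u e * Real.exp (-(κ * ρ e))) ^ 2) * Real.sqrt (∑ e, z e ^ 2) :=
          Real.sqrt_mul hU0 _
      _ ≤ Real.sqrt (Real.exp (-(κ * R)) ^ 2 * ∑ e, u e ^ 2) * Real.sqrt (∑ e, z e ^ 2) := by
          gcongr
      _ = Real.exp (-(κ * R)) * Real.sqrt (∑ e, u e ^ 2) * Real.sqrt (∑ e, z e ^ 2) := by
          rw [Real.sqrt_mul (sq_nonneg _), Real.sqrt_sq (Real.exp_pos _).le]
  -- (f) chain
  have hsqz : Real.sqrt (∑ e, z e ^ 2) ≤ Real.sqrt (∑ e, v e ^ 2) / m := by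
    rw [le_div_iff₀ hm0, mul_comm]
    exact hzle.trans (Real.sqrt_le_sqrt hwv)
  have hE0 : 0 ≤ Real.exp (-(κ * R)) * Real.sqrt (∑ e, u e ^ 2) := by positivity
  rw [hux]
  calc |∑ e, (u e * Real.exp (-(κ * ρ e))) * z e|
      ≤ Real.exp (-(κ * R)) * Real.sqrt (∑ e, u e ^ 2) * Real.sqrt (∑ e, z e ^ 2) := hCS2
    _ ≤ Real.exp (-(κ * R)) * Real.sqrt (∑ e, u e ^ 2) * (Real.sqrt (∑ e, v e ^ 2) / m) :=
        mul_le_mul_of_nonneg_left hsqz hE0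
    _ = Real.exp (-(κ * R)) / m * (Real.sqrt (∑ e, u e ^ 2) * Real.sqrt (∑ e, v e ^ 2)) := by
        field_simp

/-! ## §2  The class: symmetric, uniformly elliptic, with exponentially decaying entries in Combes–Thomas currency -/

omit [Fintype ι] [DecidableEq ι] in
/-- A pseudometric in the three axioms used here takes nonnegative values. [folklore] -/
private theorem dist_nonneg_of_axioms {dist : ι → ι → ℝ} (hd0 : ∀ e, dist e e = 0)
    (hdsymm : ∀ e e', dist e e' = dist e' e) (hdtri : ∀ e e' e'', dist e e'' ≤ dist e e' + dist e' e'')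
    (e e' : ι) : 0 ≤ dist e e' := by
  have h := hdtri e e' e
  rw [hd0, hdsymm e' e] at h
  linarith

omit [DecidableEq ι] in
/-- A symmetric real matrix that is coercive (`γ‖x‖² ≤ ⟨x, Ax⟩`, `γ > 0`) is positive definite (the bottom of the Rayleigh quotient is
positive). [cite: HornJohnson2013, Thm 4.2.2 (Rayleigh quotient) with §7.1 (7.1.1)] -/
theorem posDef_of_coercive {A : Matrix ι ι ℝ} (hA : ∀ e e', A e e' = A e' e) {γ : ℝ} (hγ0 : 0 < γ)
    (hγ : ∀ x : ι → ℝ, γ * ∑ e, x e ^ 2 ≤ ∑ e, ∑ e', A e e' * x e * x e') : A.PosDef := by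
  refine Matrix.PosDef.of_dotProduct_mulVec_pos (Matrix.IsHermitian.ext fun i j => by simpa using hA j i)
    fun x hx => ?_
  have hform : x ⬝ᵥ (A *ᵥ x) = ∑ e, ∑ e', A e e' * x e * x e' := by
    simp only [dotProduct, Matrix.mulVec, Finset.mul_sum]
    exact Finset.sum_congr rfl fun e _ => Finset.sum_congr rfl fun e' _ => by ring
  have hpos : 0 < ∑ e, x e ^ 2 := by
    obtain ⟨e, he⟩ : ∃ e, x e ≠ 0 := Function.ne_iff.mp hx
    exact lt_of_lt_of_le (by positivity) (Finset.single_le_sum (fun e _ => sq_nonneg (x e)) (Finset.mem_univ e))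
  simp only [star_trivial]
  rw [hform]
  exact lt_of_lt_of_le (mul_pos hγ0 hpos) (hγ x)

/-- **(C.2) for the class — exponential decay of the covariance `G = A⁻¹`.**  If the symmetric precision `A` on the finite
index set `ι` (pseudometric `dist`) is uniformly elliptic, `γ‖x‖² ≤ ⟨x, Ax⟩` with `γ > 0`, and its entries decay in
Combes–Thomas currency, `Σ_{e′} |A e e′|(cosh(κ·dist e e′) − 1) ≤ J < γ` (`κ ≥ 0`), then
`|A⁻¹ x y| ≤ e^{−κ·dist x y}/(γ − J)` — the class form of «`0 ≦ C_{ΔΔ′} ≦ … ≡ ‖c‖e^{−ϰ′d(Δ,Δ′)}`» (C.2) (no positivity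
claimed). [cite: BenfattoEtAl1978, Appendix C (C.2) p.164 (class form; route: Combes–Thomas 1973)] -/
theorem abs_inv_apply_le_exp {A : Matrix ι ι ℝ} (hA : ∀ e e', A e e' = A e' e) {dist : ι → ι → ℝ}
    (hd0 : ∀ e, dist e e = 0) (hdsymm : ∀ e e', dist e e' = dist e' e)
    (hdtri : ∀ e e' e'', dist e e'' ≤ dist e e' + dist e' e'')
    {γ J κ : ℝ} (hγ0 : 0 < γ)
    (hγ : ∀ x : ι → ℝ, γ * ∑ e, x e ^ 2 ≤ ∑ e, ∑ e', A e e' * x e * x e')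
    (hJ : ∀ e, ∑ e', |A e e'| * (Real.cosh (κ * dist e e') - 1) ≤ J) (hκ : 0 ≤ κ) (hm : J < γ)
    (x y : ι) : |A⁻¹ x y| ≤ Real.exp (-(κ * dist x y)) / (γ - J) := by
  have hPD : A.PosDef := posDef_of_coercive hA hγ0 hγ
  have hdet : IsUnit A.det := (Matrix.isUnit_iff_isUnit_det A).mp hPD.isUnit
  -- the column `y` of `A⁻¹` solves `A x = e_y`
  set ρ : ι → ℝ := fun e => dist e y with hρ
  have hJρ : ∀ e, ∑ e', |A e e'| * (Real.cosh (κ * (ρ e - ρ e')) - 1) ≤ J := by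
    intro e
    refine le_trans (Finset.sum_le_sum fun e' _ => mul_le_mul_of_nonneg_left ?_ (abs_nonneg _)) (hJ e)
    have hle : Real.cosh (κ * (ρ e - ρ e')) ≤ Real.cosh (κ * dist e e') := by
      rw [Real.cosh_le_cosh, abs_mul, abs_mul, abs_of_nonneg hκ,
        abs_of_nonneg (dist_nonneg_of_axioms hd0 hdsymm hdtri e e')]
      refine mul_le_mul_of_nonneg_left ?_ hκ
      rw [abs_sub_le_iff]
      constructor
      · have := hdtri e e' y; simp only [hρ]; linarith
      · have := hdtri e' e y; rw [hdsymm e' e] at this; simp only [hρ]; linarith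
    linarith
  have hx : ∀ e, ∑ e', A e e' * A⁻¹ e' y = (1 : Matrix ι ι ℝ) e y := by
    intro e
    rw [← Matrix.mul_nonsing_inv A hdet, Matrix.mul_apply]
  have h := combesThomas_pairwise_real hA ρ (R := dist x y) hγ hJρ hκ hm
    (u := fun e => if e = x then (1 : ℝ) else 0) (v := fun e => (1 : Matrix ι ι ℝ) e y) (x := fun e => A⁻¹ e y) hx
    (fun e he => by
      by_cases hex : e = x
      · subst hex; exact le_rfl
      · exact absurd (if_neg hex) he)
    (fun e he => by
      by_cases hey : e = y
      · subst hey; simp only [hρ, hd0]; exact le_rfl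
      · exact absurd (Matrix.one_apply_ne hey) he)
  have hsumu : ∑ e, (if e = x then (1 : ℝ) else 0) * A⁻¹ e y = A⁻¹ x y := by
    simp [Finset.sum_ite_eq']
  have hnu : ∑ e, (if e = x then (1 : ℝ) else 0) ^ 2 = 1 := by
    simp [Finset.sum_ite_eq']
  have hnv : ∑ e, ((1 : Matrix ι ι ℝ) e y) ^ 2 = 1 := by
    simp [Matrix.one_apply]
  rw [hsumu, hnu, hnv, Real.sqrt_one, mul_one, mul_one] at h
  exact h

/-- **Variance ceiling**: for a symmetric coercive `A` (`γ‖x‖² ≤ ⟨x, Ax⟩`, `γ > 0`), `0 < A⁻¹ x x ≤ 1/γ`.  (Class form of the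
one-site variance normalisation «E z_Δ² = ½» / (C.4).) [cite: BenfattoEtAl1978, Appendix C (C.4) p.164 (class form)] -/
theorem inv_apply_self_pos_le {A : Matrix ι ι ℝ} (hA : ∀ e e', A e e' = A e' e) {γ : ℝ} (hγ0 : 0 < γ)
    (hγ : ∀ x : ι → ℝ, γ * ∑ e, x e ^ 2 ≤ ∑ e, ∑ e', A e e' * x e * x e') (x : ι) :
    0 < A⁻¹ x x ∧ A⁻¹ x x ≤ 1 / γ := by
  have hPD : A.PosDef := posDef_of_coercive hA hγ0 hγ
  have hform : ∀ v : ι → ℝ, v ⬝ᵥ (A *ᵥ v) = ∑ e, ∑ e', A e e' * v e * v e' := by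
    intro v
    simp only [dotProduct, Matrix.mulVec, Finset.mul_sum]
    exact Finset.sum_congr rfl fun e _ => Finset.sum_congr rfl fun e' _ => by ring
  have hnorm : ∀ v : ι → ℝ, ‖(WithLp.toLp 2 v : EuclideanSpace ℝ ι)‖ ^ 2 = ∑ e, v e ^ 2 := by
    intro v
    rw [EuclideanSpace.real_norm_sq_eq]
  have hlow : ∀ v : ι → ℝ, γ * ‖(WithLp.toLp 2 v : EuclideanSpace ℝ ι)‖ ^ 2 ≤ v ⬝ᵥ A *ᵥ v := by
    intro v
    rw [hnorm, hform]
    exact hγ v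
  -- an upper form bound always exists on a finite index set: `Σ_{e,e′}|A e e′|`
  set C : ℝ := ∑ e, ∑ e', |A e e'| with hC
  have hup : ∀ v : ι → ℝ, v ⬝ᵥ A *ᵥ v ≤ C * ‖(WithLp.toLp 2 v : EuclideanSpace ℝ ι)‖ ^ 2 := by
    intro v
    rw [hnorm, hform]
    have hN : ∀ e, v e ^ 2 ≤ ∑ e', v e' ^ 2 := fun e =>
      Finset.single_le_sum (fun e' _ => sq_nonneg (v e')) (Finset.mem_univ e)
    have hterm : ∀ e e', A e e' * v e * v e' ≤ |A e e'| * ∑ e'', v e'' ^ 2 := by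
      intro e e'
      have h1 : A e e' * v e * v e' ≤ |A e e'| * (|v e| * |v e'|) := by
        rw [← abs_mul (v e), ← abs_mul]
        calc A e e' * v e * v e' = A e e' * (v e * v e') := by ring
          _ ≤ |A e e' * (v e * v e')| := le_abs_self _
      have h2 : |v e| * |v e'| ≤ ∑ e'', v e'' ^ 2 := by
        have := hN e; have := hN e'
        nlinarith [sq_nonneg (|v e| - |v e'|), sq_abs (v e), sq_abs (v e'), abs_nonneg (v e), abs_nonneg (v e')]
      exact h1.trans (mul_le_mul_of_nonneg_left h2 (abs_nonneg _))
    calc ∑ e, ∑ e', A e e' * v e * v e' ≤ ∑ e, ∑ e', |A e e'| * ∑ e'', v e'' ^ 2 :=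
          Finset.sum_le_sum fun e _ => Finset.sum_le_sum fun e' _ => hterm e e'
      _ = C * ∑ e'', v e'' ^ 2 := by
          rw [hC, Finset.sum_mul]
          refine Finset.sum_congr rfl fun e _ => ?_
          rw [Finset.sum_mul]
  have h := inv_diag_bounds hPD hγ0 hlow hup x
  exact ⟨h.1, by rw [one_div]; exact h.2⟩

/-! ## §3  Principal submatrices stay in the class (uniformly in the deleted set) -/

/-- Coercivity passes to every principal submatrix with the SAME constant (extend by zero — the lower end of eigenvalue interlacing
for principal submatrices). [cite: HornJohnson2013, Thm 4.3.28 (interlacing; lower bound only)] -/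
theorem coercive_submatrix {A : Matrix ι ι ℝ} {γ : ℝ}
    (hγ : ∀ x : ι → ℝ, γ * ∑ e, x e ^ 2 ≤ ∑ e, ∑ e', A e e' * x e * x e') (S : Finset ι) (z : S → ℝ) :
    γ * ∑ s, z s ^ 2 ≤ ∑ s, ∑ s', (A.submatrix (fun j : S => (j : ι)) (fun j : S => (j : ι))) s s' * z s * z s' := by
  have h := hγ (extendJ S z)
  have h1 : ∑ e, extendJ S z e ^ 2 = ∑ s : S, z s ^ 2 := by
    have := sum_mul_extendJ z (extendJ S z)
    simp_rw [← sq] at this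
    rw [this]
    exact Finset.sum_congr rfl fun s _ => by rw [extendJ_apply_coe, sq]
  have h2 : ∑ e, ∑ e', A e e' * extendJ S z e * extendJ S z e' = ∑ s : S, ∑ s' : S, A s s' * z s * z s' := by
    have inner : ∀ e, ∑ e', A e e' * extendJ S z e * extendJ S z e' = extendJ S z e * ∑ s' : S, A e s' * z s' := by
      intro e
      calc ∑ e', A e e' * extendJ S z e * extendJ S z e' = extendJ S z e * ∑ e', A e e' * extendJ S z e' := by
            rw [Finset.mul_sum]
            exact Finset.sum_congr rfl fun e' _ => by ring
        _ = extendJ S z e * ∑ s' : S, A e s' * z s' := by rw [sum_mul_extendJ]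
    simp_rw [inner]
    refine (sum_extendJ_mul z (fun e => ∑ s' : S, A e s' * z s')).trans ?_
    refine Finset.sum_congr rfl fun s _ => ?_
    rw [Finset.mul_sum]
    exact Finset.sum_congr rfl fun s' _ => by ring
  rw [h1, h2] at h
  simpa [Matrix.submatrix_apply] using h

omit [DecidableEq ι] in
/-- A row-defect bound with a nonnegative weight passes to every principal submatrix (fewer nonnegative terms). [folklore] -/
private theorem rowDefect_submatrix_le {A : Matrix ι ι ℝ} {w : ι → ι → ℝ} (hw : ∀ e e', 0 ≤ w e e') {J : ℝ}
    (hJ : ∀ e, ∑ e', |A e e'| * w e e' ≤ J) (S : Finset ι) (s : S) :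
    ∑ s' : S, |(A.submatrix (fun j : S => (j : ι)) (fun j : S => (j : ι))) s s'| * w s s' ≤ J := by
  have h1 : ∑ s' : S, |(A.submatrix (fun j : S => (j : ι)) (fun j : S => (j : ι))) s s'| * w s s'
      = ∑ e' ∈ S, |A s e'| * w s e' := by
    rw [← Finset.sum_coe_sort S (fun e' => |A s e'| * w s e')]
    rfl
  rw [h1]
  exact le_trans (Finset.sum_le_univ_sum_of_nonneg fun e' => mul_nonneg (abs_nonneg _) (hw _ _)) (hJ s)

/-- **(C.6) for the class, UNIFORMLY in the conditioning set — decay of `(A|_S)⁻¹` for every principal block.**  With the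
hypotheses of `abs_inv_apply_le_exp`, for every `S ⊆ ι`: `|((A|_S)⁻¹) s s′| ≤ e^{−κ·dist s s′}/(γ − J)` with the SAME constants —
by §3 of this file `(A|_{Γᶜ})⁻¹` is the conditional («Dirichlet boundary condition on Γ») covariance `C^Γ`, so this is the class form
of «`0 ≦ C^Γ_{ΔΔ′} ≦ C_{ΔΔ′}` (C.6)» read as a decay bound, uniform in `Γ` (no positivity claimed).
[cite: BenfattoEtAl1978, Appendix C (C.6) p.164 (class form; route: Combes–Thomas 1973)] -/
theorem abs_inv_submatrix_apply_le_exp {A : Matrix ι ι ℝ} (hA : ∀ e e', A e e' = A e' e) {dist : ι → ι → ℝ}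
    (hd0 : ∀ e, dist e e = 0) (hdsymm : ∀ e e', dist e e' = dist e' e)
    (hdtri : ∀ e e' e'', dist e e'' ≤ dist e e' + dist e' e'')
    {γ J κ : ℝ} (hγ0 : 0 < γ)
    (hγ : ∀ x : ι → ℝ, γ * ∑ e, x e ^ 2 ≤ ∑ e, ∑ e', A e e' * x e * x e')
    (hJ : ∀ e, ∑ e', |A e e'| * (Real.cosh (κ * dist e e') - 1) ≤ J) (hκ : 0 ≤ κ) (hm : J < γ)
    (S : Finset ι) (s s' : S) :
    |(A.submatrix (fun j : S => (j : ι)) (fun j : S => (j : ι)))⁻¹ s s'| ≤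
      Real.exp (-(κ * dist s s')) / (γ - J) := by
  have hc0 : ∀ e e', 0 ≤ Real.cosh (κ * dist e e') - 1 := fun e e' => by
    linarith [Real.one_le_cosh (κ * dist e e')]
  exact abs_inv_apply_le_exp (A := A.submatrix (fun j : S => (j : ι)) (fun j : S => (j : ι)))
    (fun a b => hA a b) (dist := fun a b : S => dist a b) (fun a => hd0 a) (fun a b => hdsymm a b)
    (fun a b c => hdtri a b c) hγ0 (coercive_submatrix hγ S)
    (fun a => rowDefect_submatrix_le (w := fun e e' => Real.cosh (κ * dist e e') - 1) hc0 hJ S a) hκ hm s s'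

/-- **Conditional variance ceiling, uniformly in the conditioning set**: `0 < ((A|_S)⁻¹) s s ≤ 1/γ` for every principal block.
[cite: BenfattoEtAl1978, Appendix C (C.6) p.164 (class form, diagonal)] -/
theorem inv_submatrix_apply_self_pos_le {A : Matrix ι ι ℝ} (hA : ∀ e e', A e e' = A e' e) {γ : ℝ} (hγ0 : 0 < γ)
    (hγ : ∀ x : ι → ℝ, γ * ∑ e, x e ^ 2 ≤ ∑ e, ∑ e', A e e' * x e * x e') (S : Finset ι) (s : S) :
    0 < (A.submatrix (fun j : S => (j : ι)) (fun j : S => (j : ι)))⁻¹ s s ∧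
      (A.submatrix (fun j : S => (j : ι)) (fun j : S => (j : ι)))⁻¹ s s ≤ 1 / γ :=
  inv_apply_self_pos_le (A := A.submatrix (fun j : S => (j : ι)) (fun j : S => (j : ι))) (fun a b => hA a b) hγ0
    (coercive_submatrix hγ S) s

/-! ## §4  Conditioning on `Γ` = «Dirichlet boundary condition on Γ»: the conditional covariance is `(A|_{Γᶜ})⁻¹` and the
conditional centre is `−(A|_{Γᶜ})⁻¹ A_{ΓᶜΓ} ξ` (print's (C.7), precision form) -/

omit [DecidableEq ι] in
/-- Block splitting of a matrix product along `Γ ⊔ Γᶜ`: `(MN)[f,g] = M[f,Γ]N[Γ,g] + M[f,Γᶜ]N[Γᶜ,g]` (multiplication of conformally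
partitioned matrices). [cite: HornJohnson2013, §0.7.2 (block multiplication of partitioned matrices)] -/
theorem submatrix_mul_add_submatrix_compl_mul [DecidableEq ι] {m n : Type*} (M N : Matrix ι ι ℝ) (Γ : Finset ι)
    (f : m → ι) (g : n → ι) :
    M.submatrix f (fun j : Γ => (j : ι)) * N.submatrix (fun j : Γ => (j : ι)) g +
        M.submatrix f (fun j : ↥Γᶜ => (j : ι)) * N.submatrix (fun j : ↥Γᶜ => (j : ι)) g =
      (M * N).submatrix f g := by
  ext i k
  simp only [Matrix.add_apply, Matrix.mul_apply, Matrix.submatrix_apply]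
  have h1 : ∑ j : Γ, M (f i) j * N j (g k) = ∑ j ∈ Γ, M (f i) j * N j (g k) :=
    Finset.sum_coe_sort Γ (fun j => M (f i) j * N j (g k))
  have h2 : ∑ j : ↥Γᶜ, M (f i) j * N j (g k) = ∑ j ∈ Γᶜ, M (f i) j * N j (g k) :=
    Finset.sum_coe_sort Γᶜ (fun j => M (f i) j * N j (g k))
  rw [h1, h2, Finset.sum_add_sum_compl]

/-- The `ΓᶜΓᶜ` block of `A·A⁻¹ = 1`: `A_{ΓᶜΓ}G_{ΓΓᶜ} + A_{ΓᶜΓᶜ}G_{ΓᶜΓᶜ} = 1`. [cite: HornJohnson2013, §0.7.3 (inverse of a partitioned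
matrix, (0.7.3.1))] -/
theorem precision_block_cc {A : Matrix ι ι ℝ} (hA : IsUnit A.det) (Γ : Finset ι) :
    A.submatrix (fun j : ↥Γᶜ => (j : ι)) (fun j : Γ => (j : ι)) *
          A⁻¹.submatrix (fun j : Γ => (j : ι)) (fun j : ↥Γᶜ => (j : ι)) +
        A.submatrix (fun j : ↥Γᶜ => (j : ι)) (fun j : ↥Γᶜ => (j : ι)) *
          A⁻¹.submatrix (fun j : ↥Γᶜ => (j : ι)) (fun j : ↥Γᶜ => (j : ι)) = 1 := by
  rw [submatrix_mul_add_submatrix_compl_mul, Matrix.mul_nonsing_inv A hA]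
  ext y y'
  simp only [Matrix.submatrix_apply, Matrix.one_apply, Subtype.ext_iff]

/-- The `ΓᶜΓ` block of `A·A⁻¹ = 1`: `A_{ΓᶜΓ}G_{ΓΓ} + A_{ΓᶜΓᶜ}G_{ΓᶜΓ} = 0`. [cite: HornJohnson2013, §0.7.3 (inverse of a partitioned
matrix, (0.7.3.1))] -/
theorem precision_block_cΓ {A : Matrix ι ι ℝ} (hA : IsUnit A.det) (Γ : Finset ι) :
    A.submatrix (fun j : ↥Γᶜ => (j : ι)) (fun j : Γ => (j : ι)) * covGram (A⁻¹ : Matrix ι ι ℝ) Γ +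
        A.submatrix (fun j : ↥Γᶜ => (j : ι)) (fun j : ↥Γᶜ => (j : ι)) *
          A⁻¹.submatrix (fun j : ↥Γᶜ => (j : ι)) (fun j : Γ => (j : ι)) = 0 := by
  have hcov : covGram (A⁻¹ : Matrix ι ι ℝ) Γ = A⁻¹.submatrix (fun j : Γ => (j : ι)) (fun j : Γ => (j : ι)) := by
    ext s t; rfl
  rw [hcov, submatrix_mul_add_submatrix_compl_mul, Matrix.mul_nonsing_inv A hA]
  ext y c
  simp only [Matrix.submatrix_apply, Matrix.zero_apply]
  have hne : (y : ι) ≠ (c : ι) := by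
    intro h
    have hy := y.2
    rw [Finset.mem_compl] at hy
    exact hy (h ▸ c.2)
  exact Matrix.one_apply_ne hne

/-- For a positive definite `A`, the Gram block `G_ΓΓ` of the covariance `G = A⁻¹` is invertible (principal submatrices of a positive
definite matrix are positive definite). [cite: HornJohnson2013, Obs. 7.1.2] -/
theorem isUnit_det_covGram_inv {A : Matrix ι ι ℝ} (hA : A.PosDef) (Γ : Finset ι) : IsUnit (covGram (A⁻¹ : Matrix ι ι ℝ) Γ).det := by
  have hcov : covGram (A⁻¹ : Matrix ι ι ℝ) Γ = A⁻¹.submatrix (fun j : Γ => (j : ι)) (fun j : Γ => (j : ι)) := by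
    ext s t; rfl
  rw [hcov]
  exact (Matrix.isUnit_iff_isUnit_det _).mp (posDef_submatrix hA.inv Γ).isUnit

/-- For a positive definite `A`, every principal block `A|_{Γᶜ}` is invertible. [cite: HornJohnson2013, Obs. 7.1.2] -/
theorem isUnit_det_submatrix_compl {A : Matrix ι ι ℝ} (hA : A.PosDef) (Γ : Finset ι) :
    IsUnit (A.submatrix (fun j : ↥Γᶜ => (j : ι)) (fun j : ↥Γᶜ => (j : ι))).det :=
  (Matrix.isUnit_iff_isUnit_det _).mp (posDef_submatrix hA Γᶜ).isUnit

/-- **The regression operator in precision form**: `G_{ΓᶜΓ}(G_ΓΓ)⁻¹ = −(A|_{Γᶜ})⁻¹A_{ΓᶜΓ}` for `G = A⁻¹`, `A` positive definite —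
the matrix behind print's centre formula (C.7) «`u_Δ = β Σ_{Δ′⊂Γ}(Σ_{Δ″∉Γ, Δ″ n.n. Δ′} C^Γ_{ΔΔ″}) z_{Δ′}`» (there `A = β(−Δ + α²)`,
`A_{Δ″Δ′} = −β` on nearest neighbours). [cite: BenfattoEtAl1978, Appendix C (C.7) p.164 (class form)] -/
theorem regression_eq_neg_inv_submatrix_mul {A : Matrix ι ι ℝ} (hA : A.PosDef) (Γ : Finset ι) :
    A⁻¹.submatrix (fun j : ↥Γᶜ => (j : ι)) (fun j : Γ => (j : ι)) * (covGram (A⁻¹ : Matrix ι ι ℝ) Γ)⁻¹ =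
      -((A.submatrix (fun j : ↥Γᶜ => (j : ι)) (fun j : ↥Γᶜ => (j : ι)))⁻¹ *
        A.submatrix (fun j : ↥Γᶜ => (j : ι)) (fun j : Γ => (j : ι))) := by
  have hdetA : IsUnit A.det := (Matrix.isUnit_iff_isUnit_det A).mp hA.isUnit
  have hB := isUnit_det_submatrix_compl hA Γ
  have hP := isUnit_det_covGram_inv hA Γ
  set B := A.submatrix (fun j : ↥Γᶜ => (j : ι)) (fun j : ↥Γᶜ => (j : ι)) with hBdef
  set A21 := A.submatrix (fun j : ↥Γᶜ => (j : ι)) (fun j : Γ => (j : ι)) with hA21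
  set G21 := A⁻¹.submatrix (fun j : ↥Γᶜ => (j : ι)) (fun j : Γ => (j : ι)) with hG21
  -- `B · (G_{ΓᶜΓ} P) = (−A_{ΓᶜΓ} G_ΓΓ) P = −A_{ΓᶜΓ}`
  have hblock : A21 * covGram (A⁻¹ : Matrix ι ι ℝ) Γ + B * G21 = 0 := precision_block_cΓ hdetA Γ
  have hBR : B * (G21 * (covGram (A⁻¹ : Matrix ι ι ℝ) Γ)⁻¹) = -A21 := by
    rw [← Matrix.mul_assoc, show B * G21 = -(A21 * covGram (A⁻¹ : Matrix ι ι ℝ) Γ) from eq_neg_of_add_eq_zero_right hblock,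
      Matrix.neg_mul, Matrix.mul_assoc, Matrix.mul_nonsing_inv _ hP, Matrix.mul_one]
  calc G21 * (covGram (A⁻¹ : Matrix ι ι ℝ) Γ)⁻¹ = B⁻¹ * (B * (G21 * (covGram (A⁻¹ : Matrix ι ι ℝ) Γ)⁻¹)) := by
        rw [← Matrix.mul_assoc, Matrix.nonsing_inv_mul _ hB, Matrix.one_mul]
    _ = -(B⁻¹ * A21) := by rw [hBR, Matrix.mul_neg]

/-- **The conditional covariance is the inverse of the principal precision block** («C^Γ is the covariance with “Dirichlet
boundary condition” on Γ»): for `A` positive definite, `G = A⁻¹` and `y, y′ ∉ Γ`,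
`G_{yy′} − Σ_{c,c′∈Γ} G_{yc}(G_ΓΓ)⁻¹_{cc′}G_{c′y′} = ((A|_{Γᶜ})⁻¹)_{yy′}` — the left side is LITERALLY the body of the chain's
`B1Eq324BenfattoLemma.condCov G Γ y y′` (there on `Site d`; here on any finite index set).
[cite: BenfattoEtAl1978, Appendix C point 2) (C.6)–(C.7) p.164 (class form)] -/
theorem schur_eq_inv_submatrix_compl {A : Matrix ι ι ℝ} (hA : A.PosDef) (Γ : Finset ι) (y y' : ↥Γᶜ) :
    A⁻¹ y y' - ∑ c : Γ, ∑ c' : Γ, A⁻¹ y c * (covGram (A⁻¹ : Matrix ι ι ℝ) Γ)⁻¹ c c' * A⁻¹ c' y' =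
      (A.submatrix (fun j : ↥Γᶜ => (j : ι)) (fun j : ↥Γᶜ => (j : ι)))⁻¹ y y' := by
  have hdetA : IsUnit A.det := (Matrix.isUnit_iff_isUnit_det A).mp hA.isUnit
  have hB := isUnit_det_submatrix_compl hA Γ
  set B := A.submatrix (fun j : ↥Γᶜ => (j : ι)) (fun j : ↥Γᶜ => (j : ι)) with hBdef
  set A21 := A.submatrix (fun j : ↥Γᶜ => (j : ι)) (fun j : Γ => (j : ι)) with hA21
  set G21 := A⁻¹.submatrix (fun j : ↥Γᶜ => (j : ι)) (fun j : Γ => (j : ι)) with hG21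
  set G12 := A⁻¹.submatrix (fun j : Γ => (j : ι)) (fun j : ↥Γᶜ => (j : ι)) with hG12
  set G22 := A⁻¹.submatrix (fun j : ↥Γᶜ => (j : ι)) (fun j : ↥Γᶜ => (j : ι)) with hG22
  set P := (covGram (A⁻¹ : Matrix ι ι ℝ) Γ)⁻¹ with hP
  -- the Schur complement as a matrix
  have hS : B * (G22 - G21 * P * G12) = 1 := by
    have hcc : A21 * G12 + B * G22 = 1 := precision_block_cc hdetA Γ
    have hreg : G21 * P = -(B⁻¹ * A21) := regression_eq_neg_inv_submatrix_mul hA Γ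
    rw [Matrix.mul_sub, hreg, Matrix.neg_mul, Matrix.mul_neg, ← Matrix.mul_assoc, ← Matrix.mul_assoc,
      Matrix.mul_nonsing_inv _ hB, Matrix.one_mul, sub_neg_eq_add, add_comm, hcc]
  have hinv : B⁻¹ = G22 - G21 * P * G12 := Matrix.inv_eq_right_inv hS
  rw [hinv, Matrix.sub_apply]
  congr 1
  rw [Matrix.mul_apply, Finset.sum_comm]
  refine Finset.sum_congr rfl fun c' _ => ?_
  rw [Matrix.mul_apply, Finset.sum_mul]
  rfl

/-- **The conditional centre in precision form, entrywise** (print's (C.7) for the class): for `A` positive definite, `G = A⁻¹`,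
boundary data `ξ` on `Γ` and `y ∉ Γ`,
`Σ_{c,c′∈Γ} G_{yc}(G_ΓΓ)⁻¹_{cc′}ξ_{c′} = −Σ_{z∉Γ} ((A|_{Γᶜ})⁻¹)_{yz} Σ_{c∈Γ} A_{zc}ξ_c` — the left side is LITERALLY the body of the
chain's `B1Eq324BenfattoLemma.condMean G Γ ξ y`. [cite: BenfattoEtAl1978, Appendix C (C.7) p.164 (class form)] -/
theorem regression_apply_eq {A : Matrix ι ι ℝ} (hA : A.PosDef) (Γ : Finset ι) (ξ : ι → ℝ) (y : ↥Γᶜ) :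
    ∑ c : Γ, ∑ c' : Γ, A⁻¹ y c * (covGram (A⁻¹ : Matrix ι ι ℝ) Γ)⁻¹ c c' * ξ c' =
      -∑ z : ↥Γᶜ, (A.submatrix (fun j : ↥Γᶜ => (j : ι)) (fun j : ↥Γᶜ => (j : ι)))⁻¹ y z *
        ∑ c : Γ, A z c * ξ c := by
  set B := A.submatrix (fun j : ↥Γᶜ => (j : ι)) (fun j : ↥Γᶜ => (j : ι)) with hBdef
  set P := (covGram (A⁻¹ : Matrix ι ι ℝ) Γ)⁻¹ with hP
  have hreg := regression_eq_neg_inv_submatrix_mul hA Γ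
  have hentry : ∀ c' : Γ, ∑ c : Γ, A⁻¹ y c * P c c' = -∑ z : ↥Γᶜ, B⁻¹ y z * A z c' := by
    intro c'
    have h := congrFun (congrFun hreg y) c'
    rw [Matrix.mul_apply, Matrix.neg_apply, Matrix.mul_apply] at h
    exact h
  calc ∑ c : Γ, ∑ c' : Γ, A⁻¹ y c * P c c' * ξ c'
      = ∑ c' : Γ, (∑ c : Γ, A⁻¹ y c * P c c') * ξ c' := by
        rw [Finset.sum_comm]
        exact Finset.sum_congr rfl fun c' _ => by rw [Finset.sum_mul]
    _ = ∑ c' : Γ, (-∑ z : ↥Γᶜ, B⁻¹ y z * A z c') * ξ c' := Finset.sum_congr rfl fun c' _ => by rw [hentry c']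
    _ = -∑ c' : Γ, ∑ z : ↥Γᶜ, B⁻¹ y z * (A z c' * ξ c') := by
        rw [← Finset.sum_neg_distrib]
        refine Finset.sum_congr rfl fun c' _ => ?_
        rw [neg_mul, Finset.sum_mul]
        exact congrArg Neg.neg (Finset.sum_congr rfl fun z _ => by ring)
    _ = -∑ z : ↥Γᶜ, B⁻¹ y z * ∑ c' : Γ, A z c' * ξ c' := by
        rw [Finset.sum_comm]
        simp_rw [Finset.mul_sum]

/-- **(C.7) for the class — the conditioning correction in precision form**: for `y, y′ ∉ Γ`,
`G_{yy′} − C^Γ_{yy′} = Σ_{c,c′∈Γ} G_{yc}(G_ΓΓ)⁻¹_{cc′}G_{c′y′} = −Σ_{z∉Γ} ((A|_{Γᶜ})⁻¹)_{yz} Σ_{c∈Γ} A_{zc} G_{cy′}`.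
[cite: BenfattoEtAl1978, Appendix C (C.6)–(C.7) p.164 (class form)] -/
theorem cov_sub_schur_eq {A : Matrix ι ι ℝ} (hA : A.PosDef) (Γ : Finset ι) (y y' : ↥Γᶜ) :
    ∑ c : Γ, ∑ c' : Γ, A⁻¹ y c * (covGram (A⁻¹ : Matrix ι ι ℝ) Γ)⁻¹ c c' * A⁻¹ c' y' =
      -∑ z : ↥Γᶜ, (A.submatrix (fun j : ↥Γᶜ => (j : ι)) (fun j : ↥Γᶜ => (j : ι)))⁻¹ y z *
        ∑ c : Γ, A z c * A⁻¹ c y' :=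
  regression_apply_eq hA Γ (fun e => A⁻¹ e y') y

/-! ## §5  Appendix C for the class: (C.6), (C.7), (C.8) with constants uniform in the conditioning set `Γ` -/

section ClassBounds

variable {A : Matrix ι ι ℝ} {dist : ι → ι → ℝ} {γ J κ : ℝ}

/-- **(C.6) for the class**: the conditional covariance `C^Γ_{yy′} = G_{yy′} − Σ G_{yc}(G_ΓΓ)⁻¹_{cc′}G_{c′y′}` (the body of the chain's
`condCov`) decays exponentially with the UNCONDITIONED class constants, for every `Γ`:
`|C^Γ_{yy′}| ≤ e^{−κ·dist y y′}/(γ − J)`. [cite: BenfattoEtAl1978, Appendix C (C.6) p.164 (class form; route: Combes–Thomas 1973)] -/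
theorem abs_schur_le_exp (hA : ∀ e e', A e e' = A e' e)
    (hd0 : ∀ e, dist e e = 0) (hdsymm : ∀ e e', dist e e' = dist e' e)
    (hdtri : ∀ e e' e'', dist e e'' ≤ dist e e' + dist e' e'') (hγ0 : 0 < γ)
    (hγ : ∀ x : ι → ℝ, γ * ∑ e, x e ^ 2 ≤ ∑ e, ∑ e', A e e' * x e * x e')
    (hJ : ∀ e, ∑ e', |A e e'| * (Real.cosh (κ * dist e e') - 1) ≤ J) (hκ : 0 ≤ κ) (hm : J < γ)
    (Γ : Finset ι) (y y' : ↥Γᶜ) :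
    |A⁻¹ y y' - ∑ c : Γ, ∑ c' : Γ, A⁻¹ y c * (covGram (A⁻¹ : Matrix ι ι ℝ) Γ)⁻¹ c c' * A⁻¹ c' y'| ≤
      Real.exp (-(κ * dist y y')) / (γ - J) := by
  rw [schur_eq_inv_submatrix_compl (posDef_of_coercive hA hγ0 hγ) Γ y y']
  exact abs_inv_submatrix_apply_le_exp hA hd0 hdsymm hdtri hγ0 hγ hJ hκ hm Γᶜ y y'

/-- **(C.6) for the class, diagonal**: `0 < C^Γ_{yy} ≤ 1/γ` for every `Γ` and `y ∉ Γ` (conditional variance floor is positivity,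
ceiling is the ellipticity constant). [cite: BenfattoEtAl1978, Appendix C (C.6) p.164 (class form, diagonal)] -/
theorem schur_self_pos_le (hA : ∀ e e', A e e' = A e' e) (hγ0 : 0 < γ)
    (hγ : ∀ x : ι → ℝ, γ * ∑ e, x e ^ 2 ≤ ∑ e, ∑ e', A e e' * x e * x e') (Γ : Finset ι) (y : ↥Γᶜ) :
    0 < A⁻¹ y y - ∑ c : Γ, ∑ c' : Γ, A⁻¹ y c * (covGram (A⁻¹ : Matrix ι ι ℝ) Γ)⁻¹ c c' * A⁻¹ c' y ∧
      A⁻¹ y y - ∑ c : Γ, ∑ c' : Γ, A⁻¹ y c * (covGram (A⁻¹ : Matrix ι ι ℝ) Γ)⁻¹ c c' * A⁻¹ c' y ≤ 1 / γ := by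
  rw [schur_eq_inv_submatrix_compl (posDef_of_coercive hA hγ0 hγ) Γ y y]
  exact inv_submatrix_apply_self_pos_le hA hγ0 hγ Γᶜ y

/-- **(C.8) for the class — the conditional centre is controlled by the boundary data through the decaying kernel
`(A|_{Γᶜ})⁻¹ A_{ΓᶜΓ}`**: for `y ∉ Γ`,
`|u_y| = |Σ_{c,c′∈Γ} G_{yc}(G_ΓΓ)⁻¹_{cc′}ξ_{c′}| ≤ (γ − J)⁻¹ Σ_{z∉Γ} e^{−κ·dist y z} Σ_{c∈Γ} |A_{zc}||ξ_c|`.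
[cite: BenfattoEtAl1978, Appendix C (C.8) p.164 (class form)] -/
theorem abs_regression_le (hA : ∀ e e', A e e' = A e' e)
    (hd0 : ∀ e, dist e e = 0) (hdsymm : ∀ e e', dist e e' = dist e' e)
    (hdtri : ∀ e e' e'', dist e e'' ≤ dist e e' + dist e' e'') (hγ0 : 0 < γ)
    (hγ : ∀ x : ι → ℝ, γ * ∑ e, x e ^ 2 ≤ ∑ e, ∑ e', A e e' * x e * x e')
    (hJ : ∀ e, ∑ e', |A e e'| * (Real.cosh (κ * dist e e') - 1) ≤ J) (hκ : 0 ≤ κ) (hm : J < γ)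
    (Γ : Finset ι) (ξ : ι → ℝ) (y : ↥Γᶜ) :
    |∑ c : Γ, ∑ c' : Γ, A⁻¹ y c * (covGram (A⁻¹ : Matrix ι ι ℝ) Γ)⁻¹ c c' * ξ c'| ≤
      1 / (γ - J) * ∑ z : ↥Γᶜ, Real.exp (-(κ * dist y z)) * ∑ c : Γ, |A z c| * |ξ c| := by
  rw [regression_apply_eq (posDef_of_coercive hA hγ0 hγ) Γ ξ y, abs_neg, Finset.mul_sum]
  refine (Finset.abs_sum_le_sum_abs _ _).trans (Finset.sum_le_sum fun z _ => ?_)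
  rw [abs_mul]
  have h1 := abs_inv_submatrix_apply_le_exp hA hd0 hdsymm hdtri hγ0 hγ hJ hκ hm Γᶜ y z
  have h2 : |∑ c : Γ, A z c * ξ c| ≤ ∑ c : Γ, |A z c| * |ξ c| :=
    (Finset.abs_sum_le_sum_abs _ _).trans (le_of_eq (Finset.sum_congr rfl fun c _ => abs_mul _ _))
  have h3 : 0 ≤ ∑ c : Γ, |A z c| * |ξ c| := Finset.sum_nonneg fun c _ => mul_nonneg (abs_nonneg _) (abs_nonneg _)
  calc |(A.submatrix (fun j : ↥Γᶜ => (j : ι)) (fun j : ↥Γᶜ => (j : ι)))⁻¹ y z| * |∑ c : Γ, A z c * ξ c|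
      ≤ Real.exp (-(κ * dist y z)) / (γ - J) * ∑ c : Γ, |A z c| * |ξ c| :=
        mul_le_mul h1 h2 (abs_nonneg _) (by have := hm; positivity)
    _ = 1 / (γ - J) * (Real.exp (-(κ * dist y z)) * ∑ c : Γ, |A z c| * |ξ c|) := by ring

/-- **(C.8) for the class, with print's growing thresholds**: if the boundary data satisfy `|ξ_c| ≤ t(1 + δ_c)` on `Γ` for a
nonnegative profile `δ` that is 1-Lipschitz for `dist` (print: `δ = d(·, I)`, `t = b`), then at every `y ∉ Γ` the centre obeys
`|u_y| ≤ (VM/(γ − J))·t·(1 + δ_y)` with the two growth constants `Σ_{e′} e^{−κ·dist e e′}(1 + dist e e′) ≤ V`,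
`Σ_{e′} |A e e′|(1 + dist e e′) ≤ M` — print's `|u_Δ| ≤ ((α² + 2d)/α²)² b(1 + d(Δ, I))`.
[cite: BenfattoEtAl1978, Appendix C (C.8) p.164 (class form)] -/
theorem abs_regression_le_profile (hA : ∀ e e', A e e' = A e' e)
    (hd0 : ∀ e, dist e e = 0) (hdsymm : ∀ e e', dist e e' = dist e' e)
    (hdtri : ∀ e e' e'', dist e e'' ≤ dist e e' + dist e' e'') (hγ0 : 0 < γ)
    (hγ : ∀ x : ι → ℝ, γ * ∑ e, x e ^ 2 ≤ ∑ e, ∑ e', A e e' * x e * x e')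
    (hJ : ∀ e, ∑ e', |A e e'| * (Real.cosh (κ * dist e e') - 1) ≤ J) (hκ : 0 ≤ κ) (hm : J < γ)
    {V M t : ℝ} (hV : ∀ e, ∑ e', Real.exp (-(κ * dist e e')) * (1 + dist e e') ≤ V)
    (hM : ∀ e, ∑ e', |A e e'| * (1 + dist e e') ≤ M) (ht : 0 ≤ t)
    (δ : ι → ℝ) (hδ0 : ∀ e, 0 ≤ δ e) (hδ : ∀ e e', δ e' ≤ δ e + dist e e')
    (Γ : Finset ι) (ξ : ι → ℝ) (hξ : ∀ c ∈ Γ, |ξ c| ≤ t * (1 + δ c)) (y : ↥Γᶜ) :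
    |∑ c : Γ, ∑ c' : Γ, A⁻¹ y c * (covGram (A⁻¹ : Matrix ι ι ℝ) Γ)⁻¹ c c' * ξ c'| ≤
      V * M / (γ - J) * t * (1 + δ y) := by
  have hdnn := dist_nonneg_of_axioms hd0 hdsymm hdtri
  have hγJ : 0 < γ - J := by linarith
  refine (abs_regression_le hA hd0 hdsymm hdtri hγ0 hγ hJ hκ hm Γ ξ y).trans ?_
  -- inner sum over `c ∈ Γ`
  have hin : ∀ z : ι, ∑ c : Γ, |A z c| * |ξ c| ≤ t * (1 + δ y) * (1 + dist y z) * M := by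
    intro z
    have hc : ∀ c : Γ, |A z c| * |ξ c| ≤ t * (1 + δ y) * (1 + dist y z) * (|A z c| * (1 + dist z c)) := by
      intro c
      have h1 : |ξ c| ≤ t * (1 + δ c) := hξ c c.2
      have h2 : 1 + δ c ≤ (1 + δ y) * (1 + dist y z) * (1 + dist z c) := by
        have := hδ (y : ι) z; have := hδ z (c : ι); have := hδ0 (y : ι); have := hdnn (y : ι) z; have := hdnn z (c : ι)
        nlinarith [mul_nonneg (hδ0 y) (hdnn y z), mul_nonneg (mul_nonneg (hδ0 y) (hdnn y z)) (hdnn z c),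
          mul_nonneg (hδ0 y) (hdnn z c), mul_nonneg (hdnn y z) (hdnn z c)]
      calc |A z c| * |ξ c| ≤ |A z c| * (t * ((1 + δ y) * (1 + dist y z) * (1 + dist z c))) :=
            mul_le_mul_of_nonneg_left (h1.trans (mul_le_mul_of_nonneg_left h2 ht)) (abs_nonneg _)
        _ = t * (1 + δ y) * (1 + dist y z) * (|A z c| * (1 + dist z c)) := by ring
    have hsub : ∑ c : Γ, |A z c| * (1 + dist z c) ≤ M := by
      have h := Finset.sum_coe_sort Γ (fun c => |A z c| * (1 + dist z c))
      rw [h]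
      exact le_trans (Finset.sum_le_univ_sum_of_nonneg fun c => mul_nonneg (abs_nonneg _)
        (by linarith [hdnn z c])) (hM z)
    have hpre : 0 ≤ t * (1 + δ y) * (1 + dist y z) := by
      have := hδ0 y; have := hdnn (y : ι) z; positivity
    calc ∑ c : Γ, |A z c| * |ξ c| ≤ ∑ c : Γ, t * (1 + δ y) * (1 + dist y z) * (|A z c| * (1 + dist z c)) :=
          Finset.sum_le_sum fun c _ => hc c
      _ = t * (1 + δ y) * (1 + dist y z) * ∑ c : Γ, |A z c| * (1 + dist z c) := by rw [Finset.mul_sum]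
      _ ≤ t * (1 + δ y) * (1 + dist y z) * M := mul_le_mul_of_nonneg_left hsub hpre
  -- outer sum over `z ∉ Γ`
  have hM0 : 0 ≤ M := le_trans (Finset.sum_nonneg fun e' _ => mul_nonneg (abs_nonneg _)
    (by linarith [hdnn (y : ι) e'])) (hM y)
  have hout : ∑ z : ↥Γᶜ, Real.exp (-(κ * dist y z)) * ∑ c : Γ, |A z c| * |ξ c| ≤ t * (1 + δ y) * M * V := by
    calc ∑ z : ↥Γᶜ, Real.exp (-(κ * dist y z)) * ∑ c : Γ, |A z c| * |ξ c|
        ≤ ∑ z : ↥Γᶜ, Real.exp (-(κ * dist y z)) * (t * (1 + δ y) * (1 + dist y z) * M) :=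
          Finset.sum_le_sum fun z _ => mul_le_mul_of_nonneg_left (hin z) (Real.exp_pos _).le
      _ = t * (1 + δ y) * M * ∑ z : ↥Γᶜ, Real.exp (-(κ * dist y z)) * (1 + dist y z) := by
          rw [Finset.mul_sum]
          exact Finset.sum_congr rfl fun z _ => by ring
      _ ≤ t * (1 + δ y) * M * V := by
          refine mul_le_mul_of_nonneg_left ?_ (by have := hδ0 y; positivity)
          have h := Finset.sum_coe_sort Γᶜ (fun z => Real.exp (-(κ * dist y z)) * (1 + dist y z))
          rw [h]
          exact le_trans (Finset.sum_le_univ_sum_of_nonneg fun z => mul_nonneg (Real.exp_pos _).le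
            (by linarith [hdnn (y : ι) z])) (hV y)
  calc 1 / (γ - J) * ∑ z : ↥Γᶜ, Real.exp (-(κ * dist y z)) * ∑ c : Γ, |A z c| * |ξ c|
      ≤ 1 / (γ - J) * (t * (1 + δ y) * M * V) := mul_le_mul_of_nonneg_left hout (by positivity)
    _ = V * M / (γ - J) * t * (1 + δ y) := by
        field_simp

/-- **(C.7) for the class — conditioning far away changes the covariance little**:
`|G_{yy′} − C^Γ_{yy′}| ≤ (γ − J)⁻² Σ_{z∉Γ} Σ_{c∈Γ} e^{−κ·dist y z}|A_{zc}|e^{−κ·dist c y′}`.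
[cite: BenfattoEtAl1978, Appendix C (C.6)–(C.7) p.164 (class form)] -/
theorem abs_cov_sub_schur_le (hA : ∀ e e', A e e' = A e' e)
    (hd0 : ∀ e, dist e e = 0) (hdsymm : ∀ e e', dist e e' = dist e' e)
    (hdtri : ∀ e e' e'', dist e e'' ≤ dist e e' + dist e' e'') (hγ0 : 0 < γ)
    (hγ : ∀ x : ι → ℝ, γ * ∑ e, x e ^ 2 ≤ ∑ e, ∑ e', A e e' * x e * x e')
    (hJ : ∀ e, ∑ e', |A e e'| * (Real.cosh (κ * dist e e') - 1) ≤ J) (hκ : 0 ≤ κ) (hm : J < γ)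
    (Γ : Finset ι) (y y' : ↥Γᶜ) :
    |∑ c : Γ, ∑ c' : Γ, A⁻¹ y c * (covGram (A⁻¹ : Matrix ι ι ℝ) Γ)⁻¹ c c' * A⁻¹ c' y'| ≤
      (1 / (γ - J)) ^ 2 * ∑ z : ↥Γᶜ, ∑ c : Γ,
        Real.exp (-(κ * dist y z)) * |A z c| * Real.exp (-(κ * dist c y')) := by
  have hγJ : 0 < γ - J := by linarith
  rw [cov_sub_schur_eq (posDef_of_coercive hA hγ0 hγ) Γ y y', abs_neg, Finset.mul_sum]
  refine (Finset.abs_sum_le_sum_abs _ _).trans (Finset.sum_le_sum fun z _ => ?_)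
  rw [abs_mul, Finset.mul_sum]
  have h1 := abs_inv_submatrix_apply_le_exp hA hd0 hdsymm hdtri hγ0 hγ hJ hκ hm Γᶜ y z
  have h2 : |∑ c : Γ, A z c * A⁻¹ c y'| ≤ ∑ c : Γ, |A z c| * (Real.exp (-(κ * dist c y')) / (γ - J)) := by
    refine (Finset.abs_sum_le_sum_abs _ _).trans (Finset.sum_le_sum fun c _ => ?_)
    rw [abs_mul]
    exact mul_le_mul_of_nonneg_left (abs_inv_apply_le_exp hA hd0 hdsymm hdtri hγ0 hγ hJ hκ hm c y') (abs_nonneg _)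
  have h3 : 0 ≤ ∑ c : Γ, |A z c| * (Real.exp (-(κ * dist c y')) / (γ - J)) :=
    Finset.sum_nonneg fun c _ => by positivity
  calc |(A.submatrix (fun j : ↥Γᶜ => (j : ι)) (fun j : ↥Γᶜ => (j : ι)))⁻¹ y z| * |∑ c : Γ, A z c * A⁻¹ c y'|
      ≤ Real.exp (-(κ * dist y z)) / (γ - J) * ∑ c : Γ, |A z c| * (Real.exp (-(κ * dist c y')) / (γ - J)) :=
        mul_le_mul h1 h2 (abs_nonneg _) (by positivity)
    _ = ∑ c : Γ, (1 / (γ - J)) ^ 2 * (Real.exp (-(κ * dist y z)) * |A z c| * Real.exp (-(κ * dist c y'))) := by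
        rw [Finset.mul_sum]
        exact Finset.sum_congr rfl fun c _ => by field_simp
  
/-- **(C.7) for the class, decay away from `Γ`**: if `dist(y, Γ) ≥ D_y` and `dist(Γ, y′) ≥ D_{y′}` then
`|G_{yy′} − C^Γ_{yy′}| ≤ (V₂M₂/(γ − J)²)·e^{−(κ/2)(D_y + D_{y′})}` with the growth constants `Σ_{e′} e^{−(κ/2)dist e e′} ≤ V₂`,
`Σ_{e′} |A e e′| e^{(κ/2)dist e e′} ≤ M₂`. [cite: BenfattoEtAl1978, Appendix C (C.6)–(C.7) p.164 (class form)] -/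
theorem abs_cov_sub_schur_le_exp (hA : ∀ e e', A e e' = A e' e)
    (hd0 : ∀ e, dist e e = 0) (hdsymm : ∀ e e', dist e e' = dist e' e)
    (hdtri : ∀ e e' e'', dist e e'' ≤ dist e e' + dist e' e'') (hγ0 : 0 < γ)
    (hγ : ∀ x : ι → ℝ, γ * ∑ e, x e ^ 2 ≤ ∑ e, ∑ e', A e e' * x e * x e')
    (hJ : ∀ e, ∑ e', |A e e'| * (Real.cosh (κ * dist e e') - 1) ≤ J) (hκ : 0 ≤ κ) (hm : J < γ)
    {V₂ M₂ : ℝ} (hV : ∀ e, ∑ e', Real.exp (-(κ / 2 * dist e e')) ≤ V₂)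
    (hM : ∀ e, ∑ e', |A e e'| * Real.exp (κ / 2 * dist e e') ≤ M₂)
    (Γ : Finset ι) (y y' : ↥Γᶜ) {Dy Dy' : ℝ} (hDy : ∀ c ∈ Γ, Dy ≤ dist y c) (hDy' : ∀ c ∈ Γ, Dy' ≤ dist c y') :
    |∑ c : Γ, ∑ c' : Γ, A⁻¹ y c * (covGram (A⁻¹ : Matrix ι ι ℝ) Γ)⁻¹ c c' * A⁻¹ c' y'| ≤
      V₂ * M₂ / (γ - J) ^ 2 * Real.exp (-(κ / 2 * (Dy + Dy'))) := by
  have hdnn := dist_nonneg_of_axioms hd0 hdsymm hdtri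
  have hγJ : 0 < γ - J := by linarith
  refine (abs_cov_sub_schur_le hA hd0 hdsymm hdtri hγ0 hγ hJ hκ hm Γ y y').trans ?_
  -- termwise split of the exponential weight
  have hterm : ∀ (z : ι) (c : ι), c ∈ Γ →
      Real.exp (-(κ * dist y z)) * |A z c| * Real.exp (-(κ * dist c y')) ≤
        Real.exp (-(κ / 2 * (Dy + Dy'))) * (Real.exp (-(κ / 2 * dist y z)) * (|A z c| * Real.exp (κ / 2 * dist z c))) := by
    intro z c hc
    have hexp : Real.exp (-(κ * dist y z)) * Real.exp (-(κ * dist c y')) ≤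
        Real.exp (-(κ / 2 * (Dy + Dy'))) * Real.exp (-(κ / 2 * dist y z)) * Real.exp (κ / 2 * dist z c) := by
      rw [← Real.exp_add, ← Real.exp_add, ← Real.exp_add, Real.exp_le_exp]
      have h1 := hDy c hc; have h2 := hDy' c hc; have h3 := hdtri (y : ι) z c
      have h4 := hdnn c (y' : ι); have h5 := hdnn (y : ι) z; have h6 := hdnn z c
      nlinarith [mul_nonneg hκ h4, mul_nonneg hκ h5, mul_nonneg hκ h6]
    calc Real.exp (-(κ * dist y z)) * |A z c| * Real.exp (-(κ * dist c y'))
        = |A z c| * (Real.exp (-(κ * dist y z)) * Real.exp (-(κ * dist c y'))) := by ring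
      _ ≤ |A z c| * (Real.exp (-(κ / 2 * (Dy + Dy'))) * Real.exp (-(κ / 2 * dist y z)) * Real.exp (κ / 2 * dist z c)) :=
          mul_le_mul_of_nonneg_left hexp (abs_nonneg _)
      _ = _ := by ring
  have hin : ∀ z : ι, ∑ c : Γ, Real.exp (-(κ * dist y z)) * |A z c| * Real.exp (-(κ * dist c y')) ≤
      Real.exp (-(κ / 2 * (Dy + Dy'))) * (Real.exp (-(κ / 2 * dist y z)) * M₂) := by
    intro z
    calc ∑ c : Γ, Real.exp (-(κ * dist y z)) * |A z c| * Real.exp (-(κ * dist c y'))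
        ≤ ∑ c : Γ, Real.exp (-(κ / 2 * (Dy + Dy'))) *
            (Real.exp (-(κ / 2 * dist y z)) * (|A z c| * Real.exp (κ / 2 * dist z c))) :=
          Finset.sum_le_sum fun c _ => hterm z c c.2
      _ = Real.exp (-(κ / 2 * (Dy + Dy'))) *
            (Real.exp (-(κ / 2 * dist y z)) * ∑ c : Γ, |A z c| * Real.exp (κ / 2 * dist z c)) := by
          rw [Finset.mul_sum, Finset.mul_sum]
      _ ≤ Real.exp (-(κ / 2 * (Dy + Dy'))) * (Real.exp (-(κ / 2 * dist y z)) * M₂) := by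
          refine mul_le_mul_of_nonneg_left (mul_le_mul_of_nonneg_left ?_ (Real.exp_pos _).le) (Real.exp_pos _).le
          have h := Finset.sum_coe_sort Γ (fun c => |A z c| * Real.exp (κ / 2 * dist z c))
          rw [h]
          exact le_trans (Finset.sum_le_univ_sum_of_nonneg fun c => mul_nonneg (abs_nonneg _) (Real.exp_pos _).le)
            (hM z)
  have hM0 : 0 ≤ M₂ :=
    le_trans (Finset.sum_nonneg fun e' _ => mul_nonneg (abs_nonneg _) (Real.exp_pos _).le) (hM y)
  have hout : ∑ z : ↥Γᶜ, ∑ c : Γ, Real.exp (-(κ * dist y z)) * |A z c| * Real.exp (-(κ * dist c y')) ≤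
      Real.exp (-(κ / 2 * (Dy + Dy'))) * (V₂ * M₂) := by
    calc ∑ z : ↥Γᶜ, ∑ c : Γ, Real.exp (-(κ * dist y z)) * |A z c| * Real.exp (-(κ * dist c y'))
        ≤ ∑ z : ↥Γᶜ, Real.exp (-(κ / 2 * (Dy + Dy'))) * (Real.exp (-(κ / 2 * dist y z)) * M₂) :=
          Finset.sum_le_sum fun z _ => hin z
      _ = Real.exp (-(κ / 2 * (Dy + Dy'))) * ((∑ z : ↥Γᶜ, Real.exp (-(κ / 2 * dist y z))) * M₂) := by
          rw [Finset.sum_mul, Finset.mul_sum]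
      _ ≤ Real.exp (-(κ / 2 * (Dy + Dy'))) * (V₂ * M₂) := by
          refine mul_le_mul_of_nonneg_left (mul_le_mul_of_nonneg_right ?_ hM0) (Real.exp_pos _).le
          have h := Finset.sum_coe_sort Γᶜ (fun z => Real.exp (-(κ / 2 * dist y z)))
          rw [h]
          exact le_trans (Finset.sum_le_univ_sum_of_nonneg fun z => (Real.exp_pos _).le) (hV y)
  calc (1 / (γ - J)) ^ 2 * ∑ z : ↥Γᶜ, ∑ c : Γ, Real.exp (-(κ * dist y z)) * |A z c| * Real.exp (-(κ * dist c y'))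
      ≤ (1 / (γ - J)) ^ 2 * (Real.exp (-(κ / 2 * (Dy + Dy'))) * (V₂ * M₂)) :=
        mul_le_mul_of_nonneg_left hout (by positivity)
    _ = V₂ * M₂ / (γ - J) ^ 2 * Real.exp (-(κ / 2 * (Dy + Dy'))) := by
        field_simp

end ClassBounds

/-! ## §6  The covariance-side door: an elliptic, exponentially decaying COVARIANCE has its precision in the class -/

omit [DecidableEq ι] in
/-- Glue for the row-defect hypothesis: entrywise exponential decay at rate `κ` plus a growth sum give the Combes–Thomas row defect
at any rate `κ′` with `Σ_{e′} e^{−κ·dist e e′}(cosh(κ′·dist e e′) − 1) ≤ W`: `Σ_{e′}|M e e′|(cosh(κ′·dist e e′) − 1) ≤ KW`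
(bookkeeping that feeds an entrywise exponential-decay bound — the conclusion shape of the decay theorems for inverses of banded /
decaying matrices — back into the Combes–Thomas hypothesis). [cite: DemkoMossSmith1984, Thm 2.4 (shape of the conclusion); bookkeeping ours] -/
theorem rowDefect_le_of_abs_le_exp {M : Matrix ι ι ℝ} {dist : ι → ι → ℝ} {K κ κ' W : ℝ} (hK : 0 ≤ K)
    (hM : ∀ e e', |M e e'| ≤ K * Real.exp (-(κ * dist e e')))
    (hW : ∀ e, ∑ e', Real.exp (-(κ * dist e e')) * (Real.cosh (κ' * dist e e') - 1) ≤ W) (e : ι) :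
    ∑ e', |M e e'| * (Real.cosh (κ' * dist e e') - 1) ≤ K * W := by
  have hc0 : ∀ e', 0 ≤ Real.cosh (κ' * dist e e') - 1 := fun e' => by
    linarith [Real.one_le_cosh (κ' * dist e e')]
  calc ∑ e', |M e e'| * (Real.cosh (κ' * dist e e') - 1)
      ≤ ∑ e', K * Real.exp (-(κ * dist e e')) * (Real.cosh (κ' * dist e e') - 1) :=
        Finset.sum_le_sum fun e' _ => mul_le_mul_of_nonneg_right (hM e e') (hc0 e')
    _ = K * ∑ e', Real.exp (-(κ * dist e e')) * (Real.cosh (κ' * dist e e') - 1) := by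
        rw [Finset.mul_sum]
        exact Finset.sum_congr rfl fun e' _ => by ring
    _ ≤ K * W := mul_le_mul_of_nonneg_left (hW e) hK

/-- **The covariance-side door.**  If the COVARIANCE `G` itself is symmetric, uniformly elliptic from below (`g‖x‖² ≤ ⟨x,Gx⟩`,
`g > 0`) and bounded above (`⟨x,Gx⟩ ≤ Λ‖x‖²`), then the precision `A = G⁻¹` is uniformly elliptic with `γ = 1/Λ`; together with
`abs_inv_apply_le_exp` APPLIED TO `G` (decay of `G` in Combes–Thomas currency ⇒ `|A_{xy}| ≤ e^{−κ·dist}/(g − J_G)`) and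
`rowDefect_le_of_abs_le_exp`, this puts `A` in the class of §2 at any smaller rate — so the class may be ENTERED from propagator
bounds stated on the covariance, which is the currency of [Balaban1985UV3] p.261 «a covariance having an exponential decay property».
[cite: BenfattoEtAl1978, Appendix C point 1) (C.2)–(C.5) p.164 (class form)] -/
theorem coercive_inv_of_form_le {G : Matrix ι ι ℝ} (hG : ∀ e e', G e e' = G e' e) {g Λ : ℝ} (hg0 : 0 < g)
    (hg : ∀ x : ι → ℝ, g * ∑ e, x e ^ 2 ≤ ∑ e, ∑ e', G e e' * x e * x e')
    (hΛ : ∀ x : ι → ℝ, ∑ e, ∑ e', G e e' * x e * x e' ≤ Λ * ∑ e, x e ^ 2) (x : ι → ℝ) :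
    1 / Λ * ∑ e, x e ^ 2 ≤ ∑ e, ∑ e', G⁻¹ e e' * x e * x e' := by
  have hPD : G.PosDef := posDef_of_coercive hG hg0 hg
  have hform : ∀ (M : Matrix ι ι ℝ) (v : ι → ℝ), v ⬝ᵥ (M *ᵥ v) = ∑ e, ∑ e', M e e' * v e * v e' := by
    intro M v
    simp only [dotProduct, Matrix.mulVec, Finset.mul_sum]
    exact Finset.sum_congr rfl fun e _ => Finset.sum_congr rfl fun e' _ => by ring
  have hnorm : ∀ v : ι → ℝ, ‖(WithLp.toLp 2 v : EuclideanSpace ℝ ι)‖ ^ 2 = ∑ e, v e ^ 2 := by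
    intro v
    rw [EuclideanSpace.real_norm_sq_eq]
  have hlow : ∀ v : ι → ℝ, g * ‖(WithLp.toLp 2 v : EuclideanSpace ℝ ι)‖ ^ 2 ≤ v ⬝ᵥ G *ᵥ v := by
    intro v; rw [hnorm, hform]; exact hg v
  have hup : ∀ v : ι → ℝ, v ⬝ᵥ G *ᵥ v ≤ Λ * ‖(WithLp.toLp 2 v : EuclideanSpace ℝ ι)‖ ^ 2 := by
    intro v; rw [hnorm, hform]; exact hΛ v
  have h := (inv_form_bounds hPD hg0 hlow hup x).1
  rw [hnorm, hform, ← one_div] at h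
  exact h

/-! ## §7 (v1.1, APPEND-ONLY)  (C.5) for the class — row sums — and the linearity of the conditional centre -/

section RowSums

variable {A : Matrix ι ι ℝ} {dist : ι → ι → ℝ} {γ J κ : ℝ}

/-- **(C.5) for the class — absolute row sums of the covariance**: with the growth constant `Σ_{e′} e^{−κ·dist e e′} ≤ V₀`,
`Σ_y |G_{xy}| ≤ V₀/(γ − J)` (print: `‖C‖ ≡ Σ_{Δ′} C_{ΔΔ′} = 1/(α²β)`). [cite: BenfattoEtAl1978, Appendix C (C.5) p.164 (class form)] -/
theorem sum_abs_inv_apply_le (hA : ∀ e e', A e e' = A e' e)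
    (hd0 : ∀ e, dist e e = 0) (hdsymm : ∀ e e', dist e e' = dist e' e)
    (hdtri : ∀ e e' e'', dist e e'' ≤ dist e e' + dist e' e'') (hγ0 : 0 < γ)
    (hγ : ∀ x : ι → ℝ, γ * ∑ e, x e ^ 2 ≤ ∑ e, ∑ e', A e e' * x e * x e')
    (hJ : ∀ e, ∑ e', |A e e'| * (Real.cosh (κ * dist e e') - 1) ≤ J) (hκ : 0 ≤ κ) (hm : J < γ)
    {V₀ : ℝ} (hV : ∀ e, ∑ e', Real.exp (-(κ * dist e e')) ≤ V₀) (x : ι) :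
    ∑ y, |A⁻¹ x y| ≤ V₀ / (γ - J) := by
  have hγJ : 0 < γ - J := by linarith
  calc ∑ y, |A⁻¹ x y| ≤ ∑ y, Real.exp (-(κ * dist x y)) / (γ - J) :=
        Finset.sum_le_sum fun y _ => abs_inv_apply_le_exp hA hd0 hdsymm hdtri hγ0 hγ hJ hκ hm x y
    _ = (∑ y, Real.exp (-(κ * dist x y))) / (γ - J) := by rw [Finset.sum_div]
    _ ≤ V₀ / (γ - J) := div_le_div_of_nonneg_right (hV x) hγJ.le

/-- **(C.5)/(C.6) for the class — absolute row sums of the CONDITIONAL covariance, uniformly in `Γ`**: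
`Σ_{y′∉Γ} |C^Γ_{yy′}| ≤ V₀/(γ − J)` (the `condCov`-body summed over the free sites; class form of the bound
`Σ_{c} G(y,c) ≤ Σ_y G = 1/(α²β)` used on print's positive kernel). [cite: BenfattoEtAl1978, Appendix C (C.5)–(C.6) p.164 (class form)] -/
theorem sum_abs_schur_le (hA : ∀ e e', A e e' = A e' e)
    (hd0 : ∀ e, dist e e = 0) (hdsymm : ∀ e e', dist e e' = dist e' e)
    (hdtri : ∀ e e' e'', dist e e'' ≤ dist e e' + dist e' e'') (hγ0 : 0 < γ)
    (hγ : ∀ x : ι → ℝ, γ * ∑ e, x e ^ 2 ≤ ∑ e, ∑ e', A e e' * x e * x e')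
    (hJ : ∀ e, ∑ e', |A e e'| * (Real.cosh (κ * dist e e') - 1) ≤ J) (hκ : 0 ≤ κ) (hm : J < γ)
    {V₀ : ℝ} (hV : ∀ e, ∑ e', Real.exp (-(κ * dist e e')) ≤ V₀) (Γ : Finset ι) (y : ↥Γᶜ) :
    ∑ y' : ↥Γᶜ, |A⁻¹ y y' - ∑ c : Γ, ∑ c' : Γ, A⁻¹ y c * (covGram (A⁻¹ : Matrix ι ι ℝ) Γ)⁻¹ c c' * A⁻¹ c' y'| ≤
      V₀ / (γ - J) := by
  have hγJ : 0 < γ - J := by linarith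
  calc ∑ y' : ↥Γᶜ, |A⁻¹ y y' - ∑ c : Γ, ∑ c' : Γ, A⁻¹ y c * (covGram (A⁻¹ : Matrix ι ι ℝ) Γ)⁻¹ c c' * A⁻¹ c' y'|
      ≤ ∑ y' : ↥Γᶜ, Real.exp (-(κ * dist y y')) / (γ - J) :=
        Finset.sum_le_sum fun y' _ => abs_schur_le_exp hA hd0 hdsymm hdtri hγ0 hγ hJ hκ hm Γ y y'
    _ = (∑ y' : ↥Γᶜ, Real.exp (-(κ * dist y y'))) / (γ - J) := by rw [Finset.sum_div]
    _ ≤ V₀ / (γ - J) := by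
        refine div_le_div_of_nonneg_right ?_ hγJ.le
        have h := Finset.sum_coe_sort Γᶜ (fun y' => Real.exp (-(κ * dist y y')))
        rw [h]
        exact le_trans (Finset.sum_le_univ_sum_of_nonneg fun y' => (Real.exp_pos _).le) (hV y)

omit [Fintype ι] in
/-- **The conditional centre is linear in the boundary data**: the `condMean`-body at `ξ` minus the one at `ξ′` is the one at `ξ − ξ′`
(so `abs_regression_le` / `abs_regression_le_profile` applied to `ξ − ξ′` bound the effect of changing far-away boundary data — the
quantitative replacement of print's exact locality `condMean_freeCov_congr_of_enclosed` at an exponentially decaying precision).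
[cite: BenfattoEtAl1978, Appendix C (C.7) p.164 (class form)] -/
theorem regression_sub [Fintype ι] (G : Matrix ι ι ℝ) (Γ : Finset ι) (ξ ξ' : ι → ℝ) (y : ι) :
    (∑ c : Γ, ∑ c' : Γ, G y c * (covGram G Γ)⁻¹ c c' * ξ c') -
        ∑ c : Γ, ∑ c' : Γ, G y c * (covGram G Γ)⁻¹ c c' * ξ' c' =
      ∑ c : Γ, ∑ c' : Γ, G y c * (covGram G Γ)⁻¹ c c' * (ξ c' - ξ' c') := by
  rw [← Finset.sum_sub_distrib]
  refine Finset.sum_congr rfl fun c _ => ?_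
  rw [← Finset.sum_sub_distrib]
  exact Finset.sum_congr rfl fun c' _ => by ring

end RowSums

end Literature.MathematicalPhysics.QuantumFieldTheory.Balaban1983to89.B1Eq324BenfattoClassAppendixC

end
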